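import Literature.NumberTheory.Sieve.HeathBrownCubicHatCore
import Literature.NumberTheory.Sieve.HeathBrownCubicChainSums
import HarnessLib

/-!
# Heath-Brown's Lemma 3.7 from Lemma 7.1, I: the piece `S₄` (`|S₄ − Ŝ₄| ≪ ξτ⁻⁴·(η²X², ηX³)/log X`)

Pure-proof file (no definitions) in the deduction of **Lemma 3.7 from the corrected Lemma 7.1** of
D. R. Heath-Brown, *Primes represented by `x³ + 2y³`*, Acta Math. 186 (2001), 1–84, §7 pp. 42–47
(decomposition of **parity.S18**, `Literature.NumberTheory.Sieve.setOf_prime_cube_add_two_mul_cube_infinite`).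
Lemma 3.7 (`HeathBrown2001_lemma_3_7` of `HeathBrownCubicTypeII`) consists of ten bounds; this file
proves the two for `S₄`: "`|S₄(𝒜) − Ŝ₄(𝒜)| ≪ ξτ^{-3} η²X²/log X`" and "`|S₄(ℬ) − Ŝ₄(ℬ)| ≪ ξτ^{-3} ηX³/log X`"
(p. 17; "the treatment of `U₁^(1)` and `U₁^(2)`, and also of `S₄`, follows the lines given above,
both for `𝒜` and for `ℬ`", p. 46), in the rendered form with the common factor `ξτ^{-4}` — in fact
we obtain `O(ξ)·(main scale)`.

## The argument (pp. 42–46 specialised to one prime factor)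

`S₄(𝒵) = ∑_{X^{1+τ} ≤ N(P) < X^{3/2−τ}} S_K^≺(𝒵_P, P)` and
`Ŝ₄(𝒵) = ∑_{m} ∑_{P ∈ 𝒥(m)} (log N(P)/(mξ log X)) · G(P)` with `G(P) = #{I ∈ 𝒵 : I = P·R, R X^{mξ}-rough, N(R) square-free}`,
`m` ranging over `(1+τ)ξ^{-1} ≤ m ≤ (3/2−τ)ξ^{-1} − 1` (`mIndexCore τ 1`). Matching `(m, P) ↦ P`
(injective: a first-degree prime lies in one `𝒥(m)`), `abs_sub_le_of_matching` bounds
`|S₄ − Ŝ₄|` by four error sources: (i) unmatched `P` — of degree `≥ 2` (none for `𝒜^(K)` by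
Lemma 3.1; `≪ X³∑ N(P)^{-1} ≪ X^{3−1/3}` for `ℬ^(K)` by (7.7)) or first-degree in an edge window
`N(P) < X^{1+τ+ξ}`, `N(P) ≥ X^{3/2−τ−ξ}` (`S4_unmatched_window`); (ii) the Buchstab range between
the levels `X^{mξ}` and `N(P)` — EMPTY here (`S4_buchstab_eq`: a member `Q·P·R₂` with
`N(Q) ≤ N(P) < X^{3/2−τ}` and `R₂` rough would have `R₂ = 1` and norm `< X^{3−2τ} < X³`);
(iii) the square-free defect (`S4_sqfree_defect_le`: the cofactor is a prime of degree `≥ 2`, none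
for `𝒜^(K)`, `≪ X·X³/X^{1+τ}` for `ℬ^(K)`); (iv) the weight `1 ≤ log N(P)/(mξ log X) ≤ 1 + 1/m ≤ 1 + ξ`.
The two surviving sums of sifting functions over first-degree primes (edge windows; whole range
times `ξ`) are bounded by the corrected Lemma 7.1 in `normIn` form at level `X^{1/2}`, summed
dyadically (`sum_le_of_image_normIn`), with the SHARP Mertens weights
`∑_{window} c_K(p)/p ≤ 2ξ + O(1/log X)`, `∑_{range} c_K(p)/p ≤ 1 + O(1/log X)` (`window_normWt_le`).

## Content (namespace `Literature.NumberTheory.Sieve.CubicSieve`), everything PROVED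

* generic family (`E`, `I`, members `X³ < N(I_i) ≤ C_N X³`): `S4_index_props`, `S4_injOn`,
  `S4_buchstab_eq`, `S4_sqfree_defect_le`, `S4_sum_fibre_le`, `S4_unmatched_window`,
  **`S4_abs_sub_le`** (the four-term inequality), **`S4_bound_of_h7`** (with Lemma 7.1 as hypothesis `h7`);
* tools: `sum_le_of_image_normIn`, `window_normWt_le`, `absorb_le3`, `hbXi_div_pow_four` (`ξ/τ⁴ = τ`),
  `eventually_le_hbTau_mul_log` (`τ log X → ∞`), `absNorm_pairIdeal_bounds`, `absNorm_normWindow_bounds`;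
* **`S4_A_bound`**, **`S4_B_bound`**: `HeathBrown2001_lemma_7_1_normWeighted →` the `S₄(𝒜)`- and
  `S₄(ℬ)`-conjuncts of `HeathBrown2001_lemma_3_7` (same quantifier structure: `∀ ϖ ∈ (0,1/5) ∃ C X₀ ∀ X η …`).

## References

* D. R. Heath-Brown, *Primes represented by `x³ + 2y³`*, Acta Math. 186 (2001), 1–84: Lemma 3.7
  (p. 17), §7 pp. 42–46, (7.1), (7.3), (7.7). [cite: HeathBrownActa2001, Lemma 3.7]
* G. Harman, *Prime-Detecting Sieves*, LMS Monographs 33, Princeton (2007), §13.2. [cite: Harman2007, §13.2]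

## Mathlib / tree search

Mathlib: `Finset.sum_sigma`, `Finset.card_biUnion`, `Finset.card_biUnion_le`, `Real.rpow_lt_rpow_left_iff`,
`Real.log_le_rpow_div`, `Filter.eventually_atTop`. Tree: `HeathBrownCubicHatCore` (matching, Buchstab,
square-free defect, weights), `HeathBrownCubicChainSums` (`dyadic_sum_normIn_le`,
`exists_sum_normWt_window_le`), `HeathBrownCubicUpperBoundTools` (`eventually_upperBound_params`,
`exists_countB_le`, `sum_inv_absNorm_nonprime_le`, `countA_eq_zero_of_not_prime`, `sum_union_le_add`),
`HeathBrownCubicUpperBoundWeights` (`absorb_le`, `ten_le_log`, `log_div_log_two_add_one_le`,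
`rpow_two_sub`, `rpow_three_sub`), `HeathBrownCubicPrimesOutlineProofs` (`card_filter_not_prime_absNorm_le`),
`HeathBrownCubicTypeII` (`S4hat`, `UhatPiece`, `mIndexCore`, `Jprimes`), `HeathBrownCubicSieveDecomposition` (`S₄`).
-/

noncomputable section

open Polynomial NumberField Finset Filter Topology Asymptotics
open scoped nonZeroDivisors

namespace Literature.NumberTheory.Sieve.CubicSieve

open LFunctions.CubeRootTwoField CubicPrimes
open Literature.NumberTheory.LFunctions (idealNormCount)

section S4Generic

variable {ι : Type*} (E : Finset ι) (I : ι → Ideal (𝓞 K))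

/-! ### Elementary exponent bookkeeping at `X ≥ 2`, `0 < τ ≤ 1/8` -/

omit E I in
/-- `(X^a)² = X^{2a}` for `X ≥ 0`. [folklore] -/
theorem rpow_sq_eq {X : ℝ} (hX : 0 ≤ X) (a : ℝ) : (X ^ a) ^ 2 = X ^ (2 * a) := by
  rw [mul_comm, Real.rpow_mul hX, show ((X ^ a) ^ (2 : ℝ)) = (X ^ a) ^ ((2 : ℕ) : ℝ) by norm_num,
    Real.rpow_natCast]

omit E I in
/-- `X^3 = X^{(3 : ℝ)}`. [folklore] -/
theorem pow_three_eq_rpow (X : ℝ) : X ^ 3 = X ^ (3 : ℝ) := by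
  rw [show (3 : ℝ) = ((3 : ℕ) : ℝ) by norm_num, Real.rpow_natCast]

/-! ### The hat index set of `Ŝ₄` and the matching map `(m, P) ↦ P` -/

/-- The members of the hat index set of `Ŝ₄`: `m = (m₀)` satisfying (3.6)–(3.7) for one factor and a
first-degree prime `P₀ ∈ 𝒥(m₀)`; consequences: `X^{1+τ} ≤ X^{m₀ξ} ≤ N(P₀) < X^{(m₀+1)ξ} ≤ X^{3/2−τ}`,
`m₀ ≥ (1+τ)ξ^{-1} ≥ 1`. [cite: HeathBrownActa2001, §3 pp. 15–16] -/
theorem S4_index_props {X τ : ℝ} (hX : 1 < X) (hτ : 0 < τ) (hτ1 : τ ≤ 1)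
    {m : Fin 1 → ℕ} (hm : m ∈ mIndexCore τ 1) {P : Fin 1 → Ideal (𝓞 K)}
    (hP : P ∈ Fintype.piFinset fun i => Jprimes X τ (m i)) :
    (P 0).IsPrime ∧ P 0 ≠ ⊥ ∧ (Ideal.absNorm (P 0)).Prime ∧
      X ^ (1 + τ) ≤ X ^ ((m 0 : ℝ) * hbXi τ) ∧ X ^ ((m 0 : ℝ) * hbXi τ) ≤ (Ideal.absNorm (P 0) : ℝ) ∧
      (Ideal.absNorm (P 0) : ℝ) < X ^ (((m 0 : ℝ) + 1) * hbXi τ) ∧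
      X ^ (((m 0 : ℝ) + 1) * hbXi τ) ≤ X ^ (3 / 2 - τ) ∧
      (1 + τ) / hbXi τ ≤ (m 0 : ℝ) ∧ 1 ≤ m 0 := by
  have hξ := hbXi_pos hτ
  obtain ⟨-, -, h6, h7⟩ := (mem_mIndexCore_iff hτ).mp hm
  rw [Fin.sum_univ_one] at h6 h7
  obtain ⟨hPp, hP0, hlo, hhi, hpr⟩ := (mem_Jprimes_iff X τ).mp (Fintype.mem_piFinset.mp hP 0)
  have h6' : 1 + τ ≤ (m 0 : ℝ) * hbXi τ := by rwa [div_le_iff₀ hξ] at h6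
  have h7' : ((m 0 : ℝ) + 1) * hbXi τ ≤ 3 / 2 - τ := by rwa [le_div_iff₀ hξ] at h7
  have hm1 : 1 ≤ m 0 := by
    have h1 : (1 : ℝ) ≤ (1 + τ) / hbXi τ := by
      rw [le_div_iff₀ hξ, one_mul]
      exact (hbXi_le hτ.le hτ1).trans (by linarith)
    exact_mod_cast h1.trans h6
  exact ⟨hPp, hP0, hpr, Real.rpow_le_rpow_of_exponent_le hX.le h6', hlo, hhi,
    Real.rpow_le_rpow_of_exponent_le hX.le h7', h6, hm1⟩

/-- The matching map `(m, P) ↦ P₀` of `Ŝ₄` is injective (a first-degree prime lies in one `𝒥(m)`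
only). [cite: HeathBrownActa2001, §3 (3.4)] -/
theorem S4_injOn {X τ : ℝ} (hX : 1 < X) (hτ : 0 < τ) :
    Set.InjOn (fun b : (Σ _ : Fin 1 → ℕ, Fin 1 → Ideal (𝓞 K)) => b.2 0)
      ((mIndexCore τ 1).sigma fun m => Fintype.piFinset fun i => Jprimes X τ (m i) : Set _) := by
  rintro ⟨m, P⟩ hb ⟨m', P'⟩ hb' h
  simp only [mem_coe, mem_sigma] at hb hb'
  simp only at h
  have h1 : P 0 ∈ Jprimes X τ (m 0) := Fintype.mem_piFinset.mp hb.2 0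
  have h2 : P 0 ∈ Jprimes X τ (m' 0) := by rw [h]; exact Fintype.mem_piFinset.mp hb'.2 0
  have hm : m = m' := by
    funext i; rw [Fin.fin_one_eq_zero i]; exact Jprimes_index_unique hX hτ h1 h2
  have hP : P = P' := by
    funext i; rw [Fin.fin_one_eq_zero i]; exact h
  subst hm; subst hP; rfl

/-- **No Buchstab error for `Ŝ₄`.** For a matched prime `P₀ ∈ 𝒥(m₀)` (`X^{m₀ξ} ≥ X^{1+τ}`) the
sifting functions at the levels `X^{m₀ξ}` and `N(P₀)` agree: a member `I = Q·P₀·R₂` with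
`X^{m₀ξ} ≤ N(Q) ≤ N(P₀)` and `R₂` rough of norm `≤ C_N X³/X^{2+2τ} < X^{1+τ}` forces `R₂ = 1` and then
`N(I) ≤ N(P₀)² < X^{3−2τ}`, contradicting `N(I) > X³` (members have `X³ < N(I) ≤ C_N X³`,
`C_N < X^{3τ}`). [cite: HeathBrownActa2001, §7 p. 46] -/
theorem S4_buchstab_eq {X τ CN : ℝ} (hX : 1 < X) (hτ : 0 < τ) (hτ1 : τ ≤ 1)
    (hCN : CN < X ^ (3 * τ))
    (hE : ∀ i ∈ E, I i ≠ ⊥ ∧ X ^ 3 < (Ideal.absNorm (I i) : ℝ) ∧ (Ideal.absNorm (I i) : ℝ) ≤ CN * X ^ 3)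
    {m : Fin 1 → ℕ} (hm : m ∈ mIndexCore τ 1) {P : Fin 1 → Ideal (𝓞 K)}
    (hP : P ∈ Fintype.piFinset fun i => Jprimes X τ (m i)) :
    (famSifted E I (P 0) (X ^ ((m 0 : ℝ) * hbXi τ)) : ℝ) = famSiftedAbove E I (P 0) (P 0) := by
  classical
  obtain ⟨hPp, hP0, -, hz1, hz2, hN2, hN3, -, -⟩ := S4_index_props hX hτ hτ1 hm hP
  set z : ℝ := X ^ ((m 0 : ℝ) * hbXi τ) with hz
  have hX0 : 0 < X := by linarith
  have h0 : ∀ i ∈ E, I i ≠ ⊥ := fun i hi => (hE i hi).1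
  refine le_antisymm ?_ (by exact_mod_cast famSiftedAbove_le_famSifted E I (P 0) (P 0) hz2)
  have h := famSifted_sub_famSiftedAbove_le E I h0 (P 0) (P 0) z
  suffices hzero : ∀ Q ∈ (idealsLE (Ideal.absNorm (P 0))).filter
      (fun Q => Q.IsPrime ∧ Q ≠ ⊥ ∧ z ≤ (Ideal.absNorm Q : ℝ) ∧ PrimeLT Q (P 0)),
      (#{i ∈ E | P 0 ∣ I i ∧ Q ∣ I i ∧ IsRough z (I i)} : ℝ) = 0 by
    rw [sum_congr rfl hzero, sum_const_zero] at h
    linarith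
  intro Q hQ
  rw [mem_filter] at hQ
  obtain ⟨-, hQp, hQ0, hzQ, hlt⟩ := hQ
  rw [Nat.cast_eq_zero, card_eq_zero, filter_eq_empty_iff]
  rintro i hi ⟨hPi, hQi, hri⟩
  obtain ⟨hI0, hI1, hI2⟩ := hE i hi
  have hQP : Q ≠ P 0 := hlt.ne
  have hQndvd : ¬ Q ∣ P 0 := fun hd =>
    hQP (((hPp.isMaximal hP0).eq_of_le hQp.ne_top (Ideal.le_of_dvd hd))).symm
  obtain ⟨R₂, hR₂⟩ := mul_dvd_of_not_dvd hQp hQ0 hQndvd hPi hQi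
  -- norms
  have hNQ : (Ideal.absNorm Q : ℝ) ≤ Ideal.absNorm (P 0) := by exact_mod_cast hlt.absNorm_le
  have hNI : (Ideal.absNorm (I i) : ℝ) = Ideal.absNorm Q * Ideal.absNorm (P 0) * Ideal.absNorm R₂ := by
    rw [hR₂, map_mul, map_mul]; push_cast; ring
  have hR₂0 : R₂ ≠ ⊥ := by rintro rfl; exact hI0 (by rw [hR₂, Ideal.mul_bot])
  have hR₂rough : IsRough z R₂ := by
    have : IsRough z (Q * P 0 * R₂) := hR₂ ▸ hri
    exact (isRough_mul_iff.mp this).2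
  have hzpos : 0 < z := Real.rpow_pos_of_pos hX0 _
  have hz3 : CN * X ^ 3 < z * z * z := by
    have h1 : X ^ (1 + τ) * X ^ (1 + τ) * X ^ (1 + τ) = X ^ 3 * X ^ (3 * τ) := by
      rw [← Real.rpow_add hX0, ← Real.rpow_add hX0, pow_three_eq_rpow, ← Real.rpow_add hX0]
      ring_nf
    have h2 : X ^ (1 + τ) * X ^ (1 + τ) * X ^ (1 + τ) ≤ z * z * z := by
      have h0 : 0 ≤ X ^ (1 + τ) := Real.rpow_nonneg hX0.le _
      exact mul_le_mul (mul_le_mul hz1 hz1 h0 hzpos.le) hz1 h0 (by positivity)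
    have h3 : CN * X ^ 3 < X ^ 3 * X ^ (3 * τ) := by
      rw [mul_comm]; exact mul_lt_mul_of_pos_left hCN (by positivity)
    linarith
  have hNR₂ : (Ideal.absNorm R₂ : ℝ) < z := by
    by_contra hge
    push Not at hge
    have : z * z * z ≤ (Ideal.absNorm (I i) : ℝ) := by
      rw [hNI]
      have hzQ' : z ≤ Ideal.absNorm Q := hzQ
      have hzP' : z ≤ Ideal.absNorm (P 0) := hz2
      exact mul_le_mul (mul_le_mul hzQ' hzP' hzpos.le (Nat.cast_nonneg _)) hge hzpos.le
        (by positivity)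
    linarith
  have hR₂top : R₂ = ⊤ := eq_top_of_isRough_of_absNorm_lt hR₂0 hR₂rough hNR₂
  rw [hR₂top, Ideal.absNorm_top, Nat.cast_one, mul_one] at hNI
  have hP2 : (Ideal.absNorm (P 0) : ℝ) * Ideal.absNorm (P 0) < X ^ 3 := by
    have h1 : (Ideal.absNorm (P 0) : ℝ) < X ^ (3 / 2 - τ) := hN2.trans_le hN3
    have h2 : X ^ (3 / 2 - τ) * X ^ (3 / 2 - τ) ≤ X ^ 3 := by
      rw [← Real.rpow_add hX0, pow_three_eq_rpow]
      exact Real.rpow_le_rpow_of_exponent_le hX.le (by linarith)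
    have h0 : (0 : ℝ) ≤ Ideal.absNorm (P 0) := Nat.cast_nonneg _
    nlinarith
  have : (Ideal.absNorm (I i) : ℝ) ≤ Ideal.absNorm (P 0) * Ideal.absNorm (P 0) := by
    rw [hNI]; exact mul_le_mul_of_nonneg_right hNQ (Nat.cast_nonneg _)
  linarith

open scoped Classical in
/-- **The square-free defect of `Ŝ₄`**: a matched member with `N(I)/N(P₀)` not square-free has a
prime cofactor `R₀` of degree `≥ 2` with `X^{1+τ} ≤ N(R₀) ≤ C_N X²` (the cofactor is rough of norm
`< X^{2+2τ}`, hence prime, and a first-degree prime has square-free norm); so the defect at `P₀` is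
at most `#{i : I_i = P₀·R₀ for such an R₀}`. [cite: HeathBrownActa2001, §7 p. 45] -/
theorem S4_sqfree_defect_le {X τ CN : ℝ} (hX : 1 < X) (hτ : 0 < τ) (hτ1 : τ ≤ 1)
    (hCN : CN < X ^ (3 * τ)) (hCN1 : 1 ≤ CN)
    (hE : ∀ i ∈ E, I i ≠ ⊥ ∧ X ^ 3 < (Ideal.absNorm (I i) : ℝ) ∧ (Ideal.absNorm (I i) : ℝ) ≤ CN * X ^ 3)
    {m : Fin 1 → ℕ} (hm : m ∈ mIndexCore τ 1) {P : Fin 1 → Ideal (𝓞 K)}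
    (hP : P ∈ Fintype.piFinset fun i => Jprimes X τ (m i))
    (D : Finset (Ideal (𝓞 K)))
    (hD : ∀ R₀ : Ideal (𝓞 K), R₀.IsPrime → R₀ ≠ ⊥ → ¬ (Ideal.absNorm R₀).Prime →
      X ^ (1 + τ) ≤ (Ideal.absNorm R₀ : ℝ) → (Ideal.absNorm R₀ : ℝ) ≤ CN * X ^ 2 → R₀ ∈ D) :
    (#{i ∈ E | P 0 ∣ I i ∧ IsRough (X ^ ((m 0 : ℝ) * hbXi τ)) (I i) ∧
        ¬ Squarefree (Ideal.absNorm (I i) / Ideal.absNorm (P 0))} : ℝ) ≤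
      ∑ R₀ ∈ D, (#{i ∈ E | I i = P 0 * R₀} : ℝ) := by
  classical
  obtain ⟨hPp, hP0, -, hz1, hz2, hN2, hN3, -, -⟩ := S4_index_props hX hτ hτ1 hm hP
  set z : ℝ := X ^ ((m 0 : ℝ) * hbXi τ) with hz
  have hX0 : 0 < X := by linarith
  have hzpos : 0 < z := Real.rpow_pos_of_pos hX0 _
  have key : ∀ i ∈ E, P 0 ∣ I i → IsRough z (I i) →
      ¬ Squarefree (Ideal.absNorm (I i) / Ideal.absNorm (P 0)) → ∃ R₀ ∈ D, I i = P 0 * R₀ := by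
    intro i hi hPi hri hsq
    obtain ⟨hI0, hI1, hI2⟩ := hE i hi
    obtain ⟨R₀, hR₀⟩ := hPi
    have hR₀0 : R₀ ≠ ⊥ := by rintro rfl; exact hI0 (by rw [hR₀, Ideal.mul_bot])
    have hNP : 0 < Ideal.absNorm (P 0) :=
      Nat.pos_of_ne_zero fun h => hP0 (Ideal.absNorm_eq_zero_iff.mp h)
    have hquot : Ideal.absNorm (I i) / Ideal.absNorm (P 0) = Ideal.absNorm R₀ := by
      rw [hR₀, map_mul, Nat.mul_div_cancel_left _ hNP]
    have hNI : (Ideal.absNorm (I i) : ℝ) = Ideal.absNorm (P 0) * Ideal.absNorm R₀ := by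
      rw [hR₀, map_mul]; push_cast; ring
    have hR₀rough : IsRough z R₀ := (isRough_mul_iff.mp (hR₀ ▸ hri)).2
    have hNP0 : (0 : ℝ) < Ideal.absNorm (P 0) := by exact_mod_cast hNP
    -- `N(R₀) ≤ CN X³ / N(P₀) ≤ CN X² ` and `< z²`
    have hNR₀le : (Ideal.absNorm R₀ : ℝ) * X ^ (1 + τ) ≤ CN * X ^ 3 := by
      calc (Ideal.absNorm R₀ : ℝ) * X ^ (1 + τ) ≤ Ideal.absNorm R₀ * Ideal.absNorm (P 0) :=
            mul_le_mul_of_nonneg_left (hz1.trans hz2) (Nat.cast_nonneg _)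
        _ = Ideal.absNorm (I i) := by rw [hNI]; ring
        _ ≤ CN * X ^ 3 := hI2
    have hX1τ : 0 < X ^ (1 + τ) := Real.rpow_pos_of_pos hX0 _
    have hNR₀CN : (Ideal.absNorm R₀ : ℝ) ≤ CN * X ^ 2 := by
      have h1 : CN * X ^ 3 ≤ CN * X ^ 2 * X ^ (1 + τ) := by
        have : X ^ 3 ≤ X ^ 2 * X ^ (1 + τ) := by
          have h3 : (X:ℝ) ^ 3 = X ^ 2 * X ^ (1 : ℝ) := by rw [Real.rpow_one]; ring
          rw [h3]
          exact mul_le_mul_of_nonneg_left (Real.rpow_le_rpow_of_exponent_le hX.le (by linarith))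
            (by positivity)
        nlinarith
      exact le_of_mul_le_mul_right (hNR₀le.trans h1) hX1τ
    have hNR₀lt : (Ideal.absNorm R₀ : ℝ) < z ^ 2 := by
      have h1 : (Ideal.absNorm R₀ : ℝ) * X ^ (1 + τ) < X ^ 3 * X ^ (3 * τ) := by
        refine hNR₀le.trans_lt ?_
        rw [mul_comm (X ^ 3)]
        exact mul_lt_mul_of_pos_right hCN (by positivity)
      have h2 : X ^ 3 * X ^ (3 * τ) = X ^ (1 + τ) * (X ^ (1 + τ)) ^ 2 := by
        rw [rpow_sq_eq hX0.le, ← Real.rpow_add hX0, pow_three_eq_rpow, ← Real.rpow_add hX0]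
        ring_nf
      rw [h2, mul_comm] at h1
      have h3 : (Ideal.absNorm R₀ : ℝ) < (X ^ (1 + τ)) ^ 2 := lt_of_mul_lt_mul_left h1 hX1τ.le
      exact h3.trans_le (pow_le_pow_left₀ hX1τ.le hz1 2)
    have hR₀1 : R₀ ≠ ⊤ := by
      rintro rfl
      rw [Ideal.absNorm_top, Nat.cast_one, mul_one] at hNI
      have : (Ideal.absNorm (P 0) : ℝ) < X ^ 3 := by
        refine (hN2.trans_le hN3).trans_le ?_
        rw [pow_three_eq_rpow]
        exact Real.rpow_le_rpow_of_exponent_le hX.le (by linarith)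
      linarith
    have hR₀p : R₀.IsPrime := isPrime_of_isRough hR₀0 hR₀1 hzpos.le hR₀rough hNR₀lt
    have hnp : ¬ (Ideal.absNorm R₀).Prime := fun hp => hsq (hquot ▸ hp.prime.squarefree)
    have hzR₀ : z ≤ Ideal.absNorm R₀ := hR₀rough hR₀p (dvd_refl _)
    exact ⟨R₀, hD R₀ hR₀p hR₀0 hnp (hz1.trans hzR₀) hNR₀CN, hR₀⟩
  calc (#{i ∈ E | P 0 ∣ I i ∧ IsRough z (I i) ∧
          ¬ Squarefree (Ideal.absNorm (I i) / Ideal.absNorm (P 0))} : ℝ)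
      ≤ #(D.biUnion fun R₀ => E.filter fun i => I i = P 0 * R₀) := by
        gcongr
        intro i hi
        rw [mem_filter] at hi
        obtain ⟨hiE, hPi, hri, hsq⟩ := hi
        obtain ⟨R₀, hR₀D, hR₀⟩ := key i hiE hPi hri hsq
        exact mem_biUnion.mpr ⟨R₀, hR₀D, mem_filter.mpr ⟨hiE, hR₀⟩⟩
    _ ≤ ∑ R₀ ∈ D, (#{i ∈ E | I i = P 0 * R₀} : ℝ) := by exact_mod_cast card_biUnion_le

/-- Summing the square-free defects over the matched indices: for each `R₀` the sets
`{i : I_i = P₀·R₀}` for distinct matched `P₀` are disjoint subsets of `{i : R₀ ∣ I_i}`.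
[cite: HeathBrownActa2001, §7 p. 45] -/
theorem S4_sum_fibre_le {X τ : ℝ} (hX : 1 < X) (hτ : 0 < τ) (R₀ : Ideal (𝓞 K)) (hR₀ : R₀ ≠ ⊥) :
    ∑ b ∈ (mIndexCore τ 1).sigma (fun m => Fintype.piFinset fun i => Jprimes X τ (m i)),
        (#{i ∈ E | I i = b.2 0 * R₀} : ℝ) ≤ famCount E I R₀ := by
  classical
  set A := (mIndexCore τ 1).sigma (fun m => Fintype.piFinset fun i => Jprimes X τ (m i)) with hA
  have hdisj : Set.PairwiseDisjoint (A : Set (Σ _ : Fin 1 → ℕ, Fin 1 → Ideal (𝓞 K)))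
      (fun b => E.filter fun i => I i = b.2 0 * R₀) := by
    intro b hb b' hb' hne
    change Disjoint _ _
    rw [disjoint_filter]
    intro i _ h1 h2
    apply hne
    have h3 : b.2 0 * R₀ = b'.2 0 * R₀ := by rw [← h1, ← h2]
    have h4 : b.2 0 = b'.2 0 := mul_right_cancel₀ (show R₀ ≠ 0 from hR₀) h3
    exact S4_injOn hX hτ hb hb' h4
  have h := card_biUnion hdisj
  calc ∑ b ∈ A, (#{i ∈ E | I i = b.2 0 * R₀} : ℝ)
      = #(A.biUnion fun b => E.filter fun i => I i = b.2 0 * R₀) := by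
        rw [h]; push_cast; rfl
    _ ≤ famCount E I R₀ := by
        rw [famCount]
        exact_mod_cast card_le_card fun i hi => by
          obtain ⟨b, -, hb⟩ := mem_biUnion.mp hi
          rw [mem_filter] at hb ⊢
          exact ⟨hb.1, ⟨b.2 0, by rw [hb.2, mul_comm]⟩⟩

/-- **Unmatched first-degree primes of `S₄` lie in the two edge windows**: if `P₀` with prime norm in
`[X^{1+τ}, X^{3/2−τ})` is not `φ(m, P)` for an admissible `m = (m₀)`, then
`N(P₀) < X^{1+τ+ξ}` or `N(P₀) ≥ X^{3/2−τ−ξ}` (take `m₀` with `P₀ ∈ 𝒥(m₀)`; if `P₀` avoided both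
windows, `m₀` would satisfy (3.6)–(3.7)). [cite: HeathBrownActa2001, §7 p. 43] -/
theorem S4_unmatched_window {X τ : ℝ} (hX : 1 < X) (hτ : 0 < τ) {P₀ : Ideal (𝓞 K)}
    (hP₀ : P₀ ∈ primesNormIco (X ^ (1 + τ)) (X ^ (3 / 2 - τ))) (hpr : (Ideal.absNorm P₀).Prime)
    (hun : P₀ ∉ ((mIndexCore τ 1).sigma fun m => Fintype.piFinset fun i => Jprimes X τ (m i)).image
      (fun b : (Σ _ : Fin 1 → ℕ, Fin 1 → Ideal (𝓞 K)) => b.2 0)) :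
    (Ideal.absNorm P₀ : ℝ) < X ^ (1 + τ + hbXi τ) ∨ X ^ (3 / 2 - τ - hbXi τ) ≤ (Ideal.absNorm P₀ : ℝ) := by
  classical
  have hξ := hbXi_pos hτ
  obtain ⟨hPp, hP0, -, -⟩ := mem_primesNormIco_iff.mp hP₀
  obtain ⟨m₀, hm₀⟩ := exists_mem_Jprimes hX hτ hPp hP0 hpr
  obtain ⟨-, -, hlo, hhi, -⟩ := (mem_Jprimes_iff X τ).mp hm₀
  by_contra hcon
  rw [not_or, not_lt, not_le] at hcon
  obtain ⟨h1, h2⟩ := hcon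
  have h6 : (1 + τ) / hbXi τ ≤ (m₀ : ℝ) := by
    have : X ^ (1 + τ + hbXi τ) < X ^ (((m₀ : ℝ) + 1) * hbXi τ) := h1.trans_lt hhi
    rw [Real.rpow_lt_rpow_left_iff hX] at this
    rw [div_le_iff₀ hξ]; nlinarith
  have h7 : (m₀ : ℝ) + 1 ≤ (3 / 2 - τ) / hbXi τ := by
    have : X ^ ((m₀ : ℝ) * hbXi τ) < X ^ (3 / 2 - τ - hbXi τ) := hlo.trans_lt h2
    rw [Real.rpow_lt_rpow_left_iff hX] at this
    rw [le_div_iff₀ hξ]; nlinarith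
  have h5 : τ / hbXi τ ≤ (m₀ : ℝ) := by
    refine le_trans ?_ h6
    exact div_le_div_of_nonneg_right (by linarith) hξ.le
  have hadm : CoreAdmissible τ (fun _ : Fin 1 => m₀) := by
    refine ⟨fun a b hab => absurd hab ?_, fun _ => h5, ?_, ?_⟩
    · rw [Subsingleton.elim a b]; exact lt_irrefl _
    · simpa using h6
    · simpa using h7
  apply hun
  rw [mem_image]
  refine ⟨⟨fun _ => m₀, fun _ => P₀⟩, ?_, rfl⟩
  rw [mem_sigma]
  exact ⟨(mem_mIndexCore_iff hτ).mpr hadm, Fintype.mem_piFinset.mpr fun _ => hm₀⟩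

/-- **The generic `S₄`-approximation inequality.** For a finite family of nonzero ideals with
`X³ < N(I_i) ≤ C_N X³` (`1 ≤ C_N < X^{3τ}`), `X > 1`, `0 < τ ≤ 1/8`,
`|S₄(𝒵) − Ŝ₄(𝒵)| ≤ ∑_{N(P)∉ℙ} #𝒵_P + ∑_{P first-degree in the edge windows} S_K(𝒵_P, X^{1/2})
 + ∑_{R₀ ∈ D} #𝒵_{R₀} + ξ ∑_{P first-degree} S_K(𝒵_P, X^{1/2})`, the ranges of `P` being
`X^{1+τ} ≤ N(P) < X^{3/2−τ}`, the edge windows `N(P) < X^{1+τ+ξ}` and `N(P) ≥ X^{3/2−τ−ξ}`, and `D` any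
set containing the prime ideals of degree `≥ 2` with `X^{1+τ} ≤ N(R₀) ≤ C_N X²` (the four error
sources: unmatched primes of degree `≥ 2`, unmatched edge primes, the square-free defect, the weight
`d_S = 1 + O(ξ)`; the Buchstab error vanishes for `S₄`). [cite: HeathBrownActa2001, §7 p. 46] -/
theorem S4_abs_sub_le {X τ CN : ℝ} (hX : 1 < X) (hτ : 0 < τ) (hτ1 : τ ≤ 1 / 8)
    (hCN : CN < X ^ (3 * τ)) (hCN1 : 1 ≤ CN)
    (hE : ∀ i ∈ E, I i ≠ ⊥ ∧ X ^ 3 < (Ideal.absNorm (I i) : ℝ) ∧ (Ideal.absNorm (I i) : ℝ) ≤ CN * X ^ 3)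
    (D : Finset (Ideal (𝓞 K))) (hD0 : ∀ R₀ ∈ D, R₀ ≠ ⊥)
    (hD : ∀ R₀ : Ideal (𝓞 K), R₀.IsPrime → R₀ ≠ ⊥ → ¬ (Ideal.absNorm R₀).Prime →
      X ^ (1 + τ) ≤ (Ideal.absNorm R₀ : ℝ) → (Ideal.absNorm R₀ : ℝ) ≤ CN * X ^ 2 → R₀ ∈ D) :
    |(S₄ E I X τ : ℝ) - S4hat X τ E I| ≤
      ∑ P ∈ (primesNormIco (X ^ (1 + τ)) (X ^ (3 / 2 - τ))).filter
          (fun P => ¬ (Ideal.absNorm P).Prime), (famCount E I P : ℝ) +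
      ∑ P ∈ (primesNormIco (X ^ (1 + τ)) (X ^ (3 / 2 - τ))).filter
          (fun P => (Ideal.absNorm P).Prime ∧ ((Ideal.absNorm P : ℝ) < X ^ (1 + τ + hbXi τ) ∨
            X ^ (3 / 2 - τ - hbXi τ) ≤ (Ideal.absNorm P : ℝ))),
          (famSifted E I P (X ^ (1 / 2 : ℝ)) : ℝ) +
      ∑ R₀ ∈ D, (famCount E I R₀ : ℝ) +
      hbXi τ * ∑ P ∈ (primesNormIco (X ^ (1 + τ)) (X ^ (3 / 2 - τ))).filter
          (fun P => (Ideal.absNorm P).Prime), (famSifted E I P (X ^ (1 / 2 : ℝ)) : ℝ) := by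
  classical
  have hτ1' : τ ≤ 1 := by linarith
  have hξ := hbXi_pos hτ
  have hX0 : 0 < X := by linarith
  have h0 : ∀ i ∈ E, I i ≠ ⊥ := fun i hi => (hE i hi).1
  set R := primesNormIco (X ^ (1 + τ)) (X ^ (3 / 2 - τ)) with hR
  set A : Finset (Σ _ : Fin 1 → ℕ, Fin 1 → Ideal (𝓞 K)) :=
    (mIndexCore τ 1).sigma fun m => Fintype.piFinset fun i => Jprimes X τ (m i) with hA
  set φ : (Σ _ : Fin 1 → ℕ, Fin 1 → Ideal (𝓞 K)) → Ideal (𝓞 K) := fun b => b.2 0 with hφ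
  set F : Ideal (𝓞 K) → ℝ := fun P => (famSiftedAbove E I P P : ℝ) with hF
  set G : (Σ _ : Fin 1 → ℕ, Fin 1 → Ideal (𝓞 K)) → ℝ := fun b =>
    ∑ i ∈ E, ∑ RS ∈ divisorPairs (I i),
      if ∏ j, b.2 j = RS.2 then cCoef (X ^ ((b.1 (Fin.last 0) : ℝ) * hbXi τ)) RS.1 else 0 with hG
  set G₁ : (Σ _ : Fin 1 → ℕ, Fin 1 → Ideal (𝓞 K)) → ℝ := fun b =>
    (famSifted E I (b.2 0) (X ^ ((b.1 0 : ℝ) * hbXi τ)) : ℝ) with hG₁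
  set wt : (Σ _ : Fin 1 → ℕ, Fin 1 → Ideal (𝓞 K)) → ℝ := fun b =>
    ∏ j, Real.log (Ideal.absNorm (b.2 j)) / ((b.1 j : ℝ) * hbXi τ * Real.log X) with hwt
  -- the two sides
  have hS4 : (S₄ E I X τ : ℝ) = ∑ P ∈ R, F P := by
    rw [S₄, primeRangeSum, Nat.cast_sum]
  have hHat : S4hat X τ E I = ∑ b ∈ A, wt b * G b := by
    rw [S4hat, hA, sum_sigma]
    refine sum_congr rfl fun m _ => ?_
    rw [UhatPiece, bilin_dWeight_eq_sum_tuples]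
  have hprod : ∀ b : (Σ _ : Fin 1 → ℕ, Fin 1 → Ideal (𝓞 K)), ∏ j, b.2 j = b.2 0 := fun b =>
    Fin.prod_univ_one _
  have hlast : (Fin.last 0 : Fin 1) = 0 := rfl
  -- properties of matched indices
  have hprops : ∀ b ∈ A, (b.2 0).IsPrime ∧ b.2 0 ≠ ⊥ ∧ (Ideal.absNorm (b.2 0)).Prime ∧
      X ^ (1 + τ) ≤ X ^ ((b.1 0 : ℝ) * hbXi τ) ∧ X ^ ((b.1 0 : ℝ) * hbXi τ) ≤ (Ideal.absNorm (b.2 0) : ℝ) ∧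
      (Ideal.absNorm (b.2 0) : ℝ) < X ^ (((b.1 0 : ℝ) + 1) * hbXi τ) ∧
      X ^ (((b.1 0 : ℝ) + 1) * hbXi τ) ≤ X ^ (3 / 2 - τ) ∧
      (1 + τ) / hbXi τ ≤ (b.1 0 : ℝ) ∧ 1 ≤ b.1 0 := by
    rintro ⟨m, P⟩ hb
    rw [hA, mem_sigma] at hb
    exact S4_index_props hX hτ hτ1' hb.1 hb.2
  have hGeq : ∀ b ∈ A, G b = ∑ i ∈ E, ∑ RS ∈ divisorPairs (I i),
      if b.2 0 = RS.2 then cCoef (X ^ ((b.1 0 : ℝ) * hbXi τ)) RS.1 else 0 := by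
    intro b _
    simp only [hG, hprod b, hlast]
  have hrough : ∀ b ∈ A, IsRough (X ^ ((b.1 0 : ℝ) * hbXi τ)) (b.2 0) := by
    intro b hb
    obtain ⟨hp, hp0, -, -, hz2, -⟩ := hprops b hb
    exact isRough_of_isPrime hp hp0 hz2
  -- the matching step
  have hmatch := abs_sub_le_of_matching R A F G G₁ wt φ
    (fun b hb => by
      obtain ⟨hp, hp0, -, hz1, hz2, hN2, hN3, -⟩ := hprops b hb
      exact mem_primesNormIco_iff.mpr ⟨hp, hp0, hz1.trans hz2, hN2.trans_le hN3⟩)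
    (S4_injOn hX hτ)
    (fun P _ => Nat.cast_nonneg _)
    (fun b hb => by
      rw [hGeq b hb]
      exact hatCount_nonneg E I (fun R => by
        rcases cCoef_eq_zero_or_one (X ^ ((b.1 0 : ℝ) * hbXi τ)) R with h | h <;> simp [h]) _)
    (fun b hb => by rw [hGeq b hb]; exact hatCount_le_famSifted E I h0 _ (hrough b hb))
    (fun b hb => by
      obtain ⟨-, -, -, -, hz2, -⟩ := hprops b hb
      simp only [hF, hφ, hG₁]
      exact_mod_cast famSiftedAbove_le_famSifted E I (b.2 0) (b.2 0) hz2)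
    (fun b hb => by
      obtain ⟨-, -, -, -, -, -, -, -, hm1⟩ := hprops b hb
      rw [hA, mem_sigma] at hb
      exact (tupleWt_bounds hX hτ hm1 (fun i => by rw [Fin.fin_one_eq_zero i]) hb.2).1)
  rw [hS4, hHat]
  refine hmatch.trans ?_
  -- (1) unmatched exact terms
  have hF_count : ∀ P, F P ≤ famCount E I P := fun P => by
    simp only [hF]
    exact_mod_cast famSiftedAbove_le_famCount E I P P
  have hF_sift : ∀ P ∈ R, F P ≤ famSifted E I P (X ^ (1 / 2 : ℝ)) := fun P hP => by
    obtain ⟨-, -, h1, -⟩ := mem_primesNormIco_iff.mp hP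
    have : X ^ (1 / 2 : ℝ) ≤ (Ideal.absNorm P : ℝ) :=
      (Real.rpow_le_rpow_of_exponent_le hX.le (by linarith)).trans h1
    simp only [hF]
    exact_mod_cast famSiftedAbove_le_famSifted E I P P this
  have hun : ∑ P ∈ R.filter (fun P => P ∉ A.image φ), F P ≤
      ∑ P ∈ R.filter (fun P => ¬ (Ideal.absNorm P).Prime), (famCount E I P : ℝ) +
      ∑ P ∈ R.filter (fun P => (Ideal.absNorm P).Prime ∧ ((Ideal.absNorm P : ℝ) < X ^ (1 + τ + hbXi τ) ∨
            X ^ (3 / 2 - τ - hbXi τ) ≤ (Ideal.absNorm P : ℝ))), (famSifted E I P (X ^ (1 / 2 : ℝ)) : ℝ) := by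
    rw [← sum_filter_add_sum_filter_not (R.filter fun P => P ∉ A.image φ)
      (fun P => ¬ (Ideal.absNorm P).Prime), filter_filter, filter_filter]
    refine add_le_add ?_ ?_
    · calc ∑ P ∈ R.filter (fun P => P ∉ A.image φ ∧ ¬ (Ideal.absNorm P).Prime), F P
          ≤ ∑ P ∈ R.filter (fun P => P ∉ A.image φ ∧ ¬ (Ideal.absNorm P).Prime), (famCount E I P : ℝ) :=
            sum_le_sum fun P _ => hF_count P
        _ ≤ _ := sum_le_sum_of_subset_of_nonneg
            (monotone_filter_right _ fun P _ h => h.2) fun _ _ _ => Nat.cast_nonneg _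
    · calc ∑ P ∈ R.filter (fun P => P ∉ A.image φ ∧ ¬¬ (Ideal.absNorm P).Prime), F P
          ≤ ∑ P ∈ R.filter (fun P => P ∉ A.image φ ∧ ¬¬ (Ideal.absNorm P).Prime),
              (famSifted E I P (X ^ (1 / 2 : ℝ)) : ℝ) :=
            sum_le_sum fun P hP => hF_sift P (mem_filter.mp hP).1
        _ ≤ _ := by
            refine sum_le_sum_of_subset_of_nonneg (fun P hP => ?_) fun _ _ _ => Nat.cast_nonneg _
            rw [mem_filter] at hP ⊢
            obtain ⟨hPR, hun, hpr⟩ := hP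
            rw [not_not] at hpr
            exact ⟨hPR, hpr, S4_unmatched_window hX hτ hPR hpr hun⟩
  -- (2) no Buchstab error
  have hbuch : ∀ b ∈ A, G₁ b - F (φ b) = 0 := by
    rintro ⟨m, P⟩ hb
    rw [hA, mem_sigma] at hb
    simp only [hG₁, hF, hφ]
    rw [S4_buchstab_eq E I hX hτ hτ1' hCN hE hb.1 hb.2, sub_self]
  -- (3) square-free defect
  have hsq : ∑ b ∈ A, (G₁ b - G b) ≤ ∑ R₀ ∈ D, (famCount E I R₀ : ℝ) := by
    calc ∑ b ∈ A, (G₁ b - G b)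
        = ∑ b ∈ A, (#{i ∈ E | b.2 0 ∣ I i ∧ IsRough (X ^ ((b.1 0 : ℝ) * hbXi τ)) (I i) ∧
            ¬ Squarefree (Ideal.absNorm (I i) / Ideal.absNorm (b.2 0))} : ℝ) := by
          refine sum_congr rfl fun b hb => ?_
          rw [hGeq b hb]
          exact famSifted_sub_hatCount_eq E I h0 _ (hrough b hb)
      _ ≤ ∑ b ∈ A, ∑ R₀ ∈ D, (#{i ∈ E | I i = b.2 0 * R₀} : ℝ) := by
          refine sum_le_sum fun b hb => ?_
          obtain ⟨m, P⟩ := b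
          rw [hA, mem_sigma] at hb
          exact S4_sqfree_defect_le E I hX hτ hτ1' hCN hCN1 hE hb.1 hb.2 D hD
      _ = ∑ R₀ ∈ D, ∑ b ∈ A, (#{i ∈ E | I i = b.2 0 * R₀} : ℝ) := sum_comm
      _ ≤ ∑ R₀ ∈ D, (famCount E I R₀ : ℝ) :=
          sum_le_sum fun R₀ hR₀ => S4_sum_fibre_le E I hX hτ R₀ (hD0 R₀ hR₀)
  -- (4) the weight
  have hwt : ∑ b ∈ A, (wt b - 1) * G₁ b ≤
      hbXi τ * ∑ P ∈ R.filter (fun P => (Ideal.absNorm P).Prime), (famSifted E I P (X ^ (1 / 2 : ℝ)) : ℝ) := by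
    have step1 : ∀ b ∈ A, (wt b - 1) * G₁ b ≤ hbXi τ * famSifted E I (b.2 0) (X ^ (1 / 2 : ℝ)) := by
      intro b hb
      obtain ⟨-, -, -, hz1, -, -, -, h6, hm1⟩ := hprops b hb
      have hb' := hb
      rw [hA, mem_sigma] at hb'
      have hwb := tupleWt_bounds hX hτ hm1 (fun i => by rw [Fin.fin_one_eq_zero i]) hb'.2
      have hw1 : wt b - 1 ≤ hbXi τ := by
        have h1 : wt b ≤ 1 + 1 / (b.1 0 : ℝ) := by
          have h := hwb.2
          rw [pow_one] at h
          simpa only [hwt] using h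
        have hm0 : (0 : ℝ) < b.1 0 := by exact_mod_cast hm1
        have h2 : 1 / (b.1 0 : ℝ) ≤ hbXi τ := by
          rw [div_le_iff₀ hm0]
          rw [div_le_iff₀ hξ] at h6
          nlinarith
        linarith
      have hG₁le : G₁ b ≤ famSifted E I (b.2 0) (X ^ (1 / 2 : ℝ)) := by
        simp only [hG₁]
        have : X ^ (1 / 2 : ℝ) ≤ X ^ ((b.1 0 : ℝ) * hbXi τ) :=
          (Real.rpow_le_rpow_of_exponent_le hX.le (by linarith)).trans hz1
        exact_mod_cast famSifted_antitone E I this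
      have hG₁0 : 0 ≤ G₁ b := Nat.cast_nonneg _
      have hw0 : 0 ≤ wt b - 1 := by linarith [hwb.1]
      calc (wt b - 1) * G₁ b ≤ hbXi τ * G₁ b := mul_le_mul_of_nonneg_right hw1 hG₁0
        _ ≤ hbXi τ * famSifted E I (b.2 0) (X ^ (1 / 2 : ℝ)) := mul_le_mul_of_nonneg_left hG₁le hξ.le
    calc ∑ b ∈ A, (wt b - 1) * G₁ b ≤ ∑ b ∈ A, hbXi τ * (famSifted E I (b.2 0) (X ^ (1 / 2 : ℝ)) : ℝ) :=
          sum_le_sum step1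
      _ = hbXi τ * ∑ b ∈ A, (famSifted E I (φ b) (X ^ (1 / 2 : ℝ)) : ℝ) := by rw [mul_sum]
      _ = hbXi τ * ∑ P ∈ A.image φ, (famSifted E I P (X ^ (1 / 2 : ℝ)) : ℝ) := by
          rw [sum_image (S4_injOn hX hτ)]
      _ ≤ hbXi τ * ∑ P ∈ R.filter (fun P => (Ideal.absNorm P).Prime), (famSifted E I P (X ^ (1 / 2 : ℝ)) : ℝ) := by
          refine mul_le_mul_of_nonneg_left ?_ hξ.le
          refine sum_le_sum_of_subset_of_nonneg (fun P hP => ?_) fun _ _ _ => Nat.cast_nonneg _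
          obtain ⟨b, hb, rfl⟩ := mem_image.mp hP
          obtain ⟨hp, hp0, hpr, hz1, hz2, hN2, hN3, -⟩ := hprops b hb
          exact mem_filter.mpr ⟨mem_primesNormIco_iff.mpr ⟨hp, hp0, hz1.trans hz2, hN2.trans_le hN3⟩, hpr⟩
  -- assemble
  have hsplit : ∑ b ∈ A, ((G₁ b - F (φ b)) + (G₁ b - G b) + (wt b - 1) * G₁ b) =
      ∑ b ∈ A, (G₁ b - F (φ b)) + ∑ b ∈ A, (G₁ b - G b) + ∑ b ∈ A, (wt b - 1) * G₁ b := by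
    rw [sum_add_distrib, sum_add_distrib]
  rw [hsplit, sum_congr rfl hbuch, sum_const_zero, zero_add]
  linarith

end S4Generic

end Literature.NumberTheory.Sieve.CubicSieve

end


/-! ## Part 2: applying Lemma 7.1 — tools and the two families -/

noncomputable section

open Polynomial NumberField Finset Filter Topology Asymptotics
open scoped nonZeroDivisors

namespace Literature.NumberTheory.Sieve.CubicSieve

open LFunctions.CubeRootTwoField CubicPrimes
open Literature.NumberTheory.LFunctions (idealNormCount)

/-! ### Applying the corrected Lemma 7.1 to a family of ideals through its set of norms -/

/-- **Lemma 7.1 for a family of ideals with square-free norms in `[a, b)`** (`normIn` form, summed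
dyadically): the family is contained in the set of all ideals whose norm it meets, so for `S ≥ 0`
`∑_{Q∈T} S(Q) ≤ C (M/log min(z, X^{2−τ}/b)) ∑_{q ∈ N(T)} c_K(q)/q + (log b/log 2 + 1) C·Err`.
[cite: HeathBrownActa2001, §7 (7.3)] -/
theorem sum_le_of_image_normIn {X τ z C M Err a b : ℝ} {S : Ideal (𝓞 K) → ℝ}
    (hS0 : ∀ Q, 0 ≤ S Q)
    (h71 : ∀ (N : ℝ) (𝒬 : Finset ℕ), 0 < N → N ≤ X ^ (2 - 2 * τ) →
        (∀ q ∈ 𝒬, Squarefree q ∧ N < q ∧ (q : ℝ) ≤ 2 * N) →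
        ∑ Q ∈ normIn 𝒬, S Q ≤
          C * (M / Real.log (min z (X ^ (2 - τ) / N)) *
            ∑ Q ∈ normIn 𝒬, ((Ideal.absNorm Q : ℕ) : ℝ)⁻¹ + Err))
    (hC : 0 ≤ C) (hM : 0 ≤ M) (hErr : 0 ≤ Err) (hX : 0 < X) (ha : 2 ≤ a) (hab : a ≤ b)
    (hb : b ≤ X ^ (2 - 2 * τ)) (hm : 1 < min z (X ^ (2 - τ) / b))
    (T : Finset (Ideal (𝓞 K)))
    (hT : ∀ Q ∈ T, Squarefree (Ideal.absNorm Q) ∧ a ≤ (Ideal.absNorm Q : ℝ) ∧ (Ideal.absNorm Q : ℝ) < b) :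
    ∑ Q ∈ T, S Q ≤
      C * (M / Real.log (min z (X ^ (2 - τ) / b)) *
          ∑ q ∈ T.image Ideal.absNorm, (idealNormCount K q : ℝ) * (q : ℝ)⁻¹) +
        (Real.log b / Real.log 2 + 1) * (C * Err) := by
  classical
  have hsub : T ⊆ normIn (T.image Ideal.absNorm) := fun Q hQ =>
    mem_normIn_iff.mpr (mem_image_of_mem _ hQ)
  have h𝒬 : ∀ q ∈ T.image Ideal.absNorm, Squarefree q ∧ a ≤ (q : ℝ) ∧ (q : ℝ) < b := by
    intro q hq
    obtain ⟨Q, hQ, rfl⟩ := mem_image.mp hq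
    exact hT Q hQ
  calc ∑ Q ∈ T, S Q ≤ ∑ Q ∈ normIn (T.image Ideal.absNorm), S Q :=
        sum_le_sum_of_subset_of_nonneg hsub fun Q _ _ => hS0 Q
    _ ≤ _ := dyadic_sum_normIn_le h71 hC hM hErr hX ha hab hb hm _ h𝒬

/-- **The weight of a window of first-degree primes** (sharp Mertens): for `X ≥ 4`, `θ ≥ 1`,
`δ ≥ 0` and a family `T` of prime ideals of prime norm in `[X^θ, X^{θ+δ})`,
`∑_{q ∈ N(T)} c_K(q)/q ≤ 2δ + 2(log 2 + C₁)/log X` — the form of (7.1) used for the edge windows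
(`δ = ξ`, `jξ`) and of (7.2)'s upper bound for ranges of bounded logarithmic width.
[cite: HeathBrownActa2001, §7 (7.1)] -/
theorem window_normWt_le {C₁ : ℝ} (hC₁ : 0 ≤ C₁)
    (hwin : ∀ (lo hi : ℝ) (T : Finset ℕ), 2 ≤ lo → lo ≤ hi →
      (∀ p ∈ T, p.Prime ∧ lo < (p : ℝ) ∧ (p : ℝ) ≤ hi) →
      ∑ p ∈ T, (idealNormCount K p : ℝ) * (p : ℝ)⁻¹ ≤
        Real.log (Real.log hi / Real.log lo) + C₁ / Real.log lo)
    {X θ δ : ℝ} (hX : 4 ≤ X) (hθ : 1 ≤ θ) (hδ : 0 ≤ δ) (T : Finset (Ideal (𝓞 K)))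
    (hT : ∀ Q ∈ T, (Ideal.absNorm Q).Prime ∧ X ^ θ ≤ (Ideal.absNorm Q : ℝ) ∧
      (Ideal.absNorm Q : ℝ) < X ^ (θ + δ)) :
    ∑ q ∈ T.image Ideal.absNorm, (idealNormCount K q : ℝ) * (q : ℝ)⁻¹ ≤
      2 * δ + 2 * (Real.log 2 + C₁) / Real.log X := by
  classical
  have hX0 : 0 < X := by linarith
  have hX1 : 1 < X := by linarith
  have hlX : 0 < Real.log X := Real.log_pos hX1
  have hl2 : 0 < Real.log 2 := Real.log_pos one_lt_two
  have hlX2 : 2 * Real.log 2 ≤ Real.log X := by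
    rw [← Real.log_rpow two_pos, show (2:ℝ) ^ (2:ℝ) = 4 by norm_num]
    exact Real.log_le_log (by norm_num) hX
  set lo : ℝ := X ^ θ / 2 with hlo
  set hi : ℝ := X ^ (θ + δ) with hhi
  have hXθ : X ^ (1 : ℝ) ≤ X ^ θ := Real.rpow_le_rpow_of_exponent_le hX1.le hθ
  rw [Real.rpow_one] at hXθ
  have hlo2 : 2 ≤ lo := by rw [hlo]; linarith
  have hlohi : lo ≤ hi := by
    have h1 : X ^ θ ≤ X ^ (θ + δ) := Real.rpow_le_rpow_of_exponent_le hX1.le (by linarith)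
    have h2 : X ^ θ / 2 ≤ X ^ θ := by
      have : 0 ≤ X ^ θ := Real.rpow_nonneg hX0.le _
      linarith
    exact h2.trans h1
  have hT' : ∀ p ∈ T.image Ideal.absNorm, p.Prime ∧ lo < (p : ℝ) ∧ (p : ℝ) ≤ hi := by
    intro p hp
    obtain ⟨Q, hQ, rfl⟩ := mem_image.mp hp
    obtain ⟨hpr, h1, h2⟩ := hT Q hQ
    refine ⟨hpr, ?_, h2.le⟩
    have : 0 < X ^ θ := Real.rpow_pos_of_pos hX0 _
    rw [hlo]; linarith
  have h := hwin lo hi _ hlo2 hlohi hT'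
  -- evaluate the logarithms
  have hloglo : Real.log lo = θ * Real.log X - Real.log 2 := by
    rw [hlo, Real.log_div (Real.rpow_pos_of_pos hX0 _).ne' two_ne_zero, Real.log_rpow hX0]
  have hloghi : Real.log hi = (θ + δ) * Real.log X := by rw [hhi, Real.log_rpow hX0]
  have hden : Real.log X / 2 ≤ Real.log lo := by
    rw [hloglo]
    have : Real.log X ≤ θ * Real.log X := by nlinarith
    linarith
  have hden0 : 0 < Real.log lo := by linarith
  have hlo1 : 1 < lo := by linarith
  have h1 : Real.log (Real.log hi / Real.log lo) ≤ (δ * Real.log X + Real.log 2) / Real.log lo := by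
    refine (log_log_div_log_le hlo1 hlohi).trans ?_
    rw [Real.log_div (by linarith) (by linarith), hloghi, hloglo]
    refine div_le_div_of_nonneg_right (le_of_eq ?_) (by rw [← hloglo]; exact hden0.le)
    ring
  have hnum0 : 0 ≤ δ * Real.log X + Real.log 2 + C₁ := by positivity
  calc ∑ q ∈ T.image Ideal.absNorm, (idealNormCount K q : ℝ) * (q : ℝ)⁻¹
      ≤ (δ * Real.log X + Real.log 2) / Real.log lo + C₁ / Real.log lo := by linarith
    _ = (δ * Real.log X + Real.log 2 + C₁) / Real.log lo := by rw [← add_div]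
    _ ≤ (δ * Real.log X + Real.log 2 + C₁) / (Real.log X / 2) :=
        div_le_div_of_nonneg_left hnum0 (by positivity) hden
    _ = 2 * δ + 2 * (Real.log 2 + C₁) / Real.log X := by
        field_simp
        ring

/-- **Absorption, `X³`-version**: if `X^{−τ/5}(log X)³ ≤ τη²/log X` and `0 ≤ η ≤ 1`, then
`T·X³·X^{−δ}(log X)^j ≤ T·τηX³/log X` for `δ ≥ τ/5`, `j ≤ 3`, `T ≥ 0`. [folklore] -/
theorem absorb_le3 {X τ η L T δ : ℝ} {j : ℕ} (hX : 1 ≤ X) (hL1 : 1 ≤ L) (hT : 0 ≤ T)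
    (hη0 : 0 ≤ η) (hη1 : η ≤ 1) (hτ : 0 ≤ τ)
    (hδ : τ / 5 ≤ δ) (hj : j ≤ 3) (habs : X ^ (-τ / 5) * L ^ 3 ≤ τ * η ^ 2 / L) :
    T * (X ^ 3 * X ^ (-δ) * L ^ j) ≤ T * (τ * η * X ^ 3 / L) := by
  refine mul_le_mul_of_nonneg_left ?_ hT
  have h1 : X ^ (-δ) ≤ X ^ (-τ / 5) := Real.rpow_le_rpow_of_exponent_le hX (by linarith)
  have h2 : L ^ j ≤ L ^ 3 := pow_le_pow_right₀ hL1 hj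
  have hX3 : 0 ≤ X ^ 3 := by positivity
  have hη2 : τ * η ^ 2 / L ≤ τ * η / L := by
    refine div_le_div_of_nonneg_right ?_ (by linarith)
    have : η ^ 2 ≤ η := by nlinarith
    exact mul_le_mul_of_nonneg_left this hτ
  calc X ^ 3 * X ^ (-δ) * L ^ j ≤ X ^ 3 * (X ^ (-τ / 5) * L ^ 3) := by
        rw [mul_assoc]
        refine mul_le_mul_of_nonneg_left ?_ hX3
        exact mul_le_mul h1 h2 (by positivity) (Real.rpow_nonneg (by linarith) _)
    _ ≤ X ^ 3 * (τ * η / L) := mul_le_mul_of_nonneg_left (habs.trans hη2) hX3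
    _ = τ * η * X ^ 3 / L := by ring

/-- `ξ/τ⁴ = τ` for `ξ = τ⁵`, `τ ≠ 0` (the size of the right-hand sides of Lemma 3.7). [folklore] -/
theorem hbXi_div_pow_four {τ : ℝ} (hτ : τ ≠ 0) : hbXi τ / τ ^ 4 = τ := by
  rw [hbXi]; field_simp

/-- **Eventually `τ log X ≥ B`** for `τ = (log log X)^{−ϖ}`, `0 < ϖ ≤ 1`: indeed
`τ log X ≥ log X/log log X ≥ (log X)^{1/2}/2 → ∞` (`log u ≤ 2u^{1/2}`). [folklore] -/
theorem eventually_le_hbTau_mul_log {ϖ : ℝ} (hϖ1 : ϖ ≤ 1) (B : ℝ) :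
    ∀ᶠ X : ℝ in atTop, B ≤ hbTau ϖ X * Real.log X := by
  have hL : ∀ᶠ X : ℝ in atTop, max (Real.exp 1) (16 * B ^ 2 + 16) ≤ Real.log X :=
    Real.tendsto_log_atTop.eventually (eventually_ge_atTop _)
  filter_upwards [hL] with X hX
  set L := Real.log X with hLdef
  have hLe : Real.exp 1 ≤ L := le_trans (le_max_left _ _) hX
  have hL1 : 1 < L := by
    have : (1 : ℝ) < Real.exp 1 := by have := Real.add_one_lt_exp (one_ne_zero); linarith
    linarith
  have hL0 : 0 < L := by linarith
  set M := Real.log L with hM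
  have hM1 : 1 ≤ M := by
    rw [hM, ← Real.log_exp 1]; exact Real.log_le_log (Real.exp_pos 1) hLe
  have hM0 : 0 < M := by linarith
  -- `τ = M^{-ϖ} ≥ 1/M`
  have hτ : hbTau ϖ X = M ^ (-ϖ) := by rw [hbTau, ← hLdef, ← hM]
  have hτlow : 1 / M ≤ hbTau ϖ X := by
    rw [hτ, Real.rpow_neg hM0.le, one_div]
    refine inv_anti₀ (Real.rpow_pos_of_pos hM0 _) ?_
    calc M ^ ϖ ≤ M ^ (1 : ℝ) := Real.rpow_le_rpow_of_exponent_le hM1 hϖ1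
      _ = M := Real.rpow_one M
  -- `M = log L ≤ 2 √L`
  have hMsqrt : M ≤ 2 * Real.sqrt L := by
    have h := Real.log_le_rpow_div hL0.le (by norm_num : (0 : ℝ) < 1 / 2)
    rw [Real.sqrt_eq_rpow]
    calc M ≤ L ^ (1 / 2 : ℝ) / (1 / 2) := h
      _ = 2 * L ^ (1 / 2 : ℝ) := by ring
  have hsqrt0 : 0 < Real.sqrt L := Real.sqrt_pos.mpr hL0
  -- `τ L ≥ L / M ≥ √L / 2 ≥ B`
  have h1 : Real.sqrt L / 2 ≤ hbTau ϖ X * L := by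
    calc Real.sqrt L / 2 = L / (2 * Real.sqrt L) := by
          rw [eq_div_iff (by positivity)]
          nlinarith [Real.mul_self_sqrt hL0.le]
      _ ≤ L / M := div_le_div_of_nonneg_left hL0.le hM0 hMsqrt
      _ = 1 / M * L := by ring
      _ ≤ hbTau ϖ X * L := mul_le_mul_of_nonneg_right hτlow hL0.le
  have h2 : B ≤ Real.sqrt L / 2 := by
    have hB : 16 * B ^ 2 + 16 ≤ L := le_trans (le_max_right _ _) hX
    have h3 : (2 * |B| + 1) ^ 2 ≤ L := by nlinarith [abs_nonneg B, sq_abs B]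
    have h4 : 2 * |B| + 1 ≤ Real.sqrt L := by
      rw [Real.le_sqrt (by positivity) hL0.le]; exact h3
    linarith [le_abs_self B]
  exact h2.trans h1

/-- The members of `𝒜^(K)` have `3X³ < N ≤ 24X³` for `0 ≤ η ≤ 1` (`X < x, y ≤ 2X`).
[cite: HeathBrownActa2001, §3 p. 10] -/
theorem absNorm_pairIdeal_bounds {X η : ℝ} (hX : 0 < X) (hη1 : η ≤ 1)
    {xy : ℕ × ℕ} (hxy : xy ∈ boxPairs X η) :
    X ^ 3 < (Ideal.absNorm (pairIdeal xy) : ℝ) ∧ (Ideal.absNorm (pairIdeal xy) : ℝ) ≤ 24 * X ^ 3 := by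
  rw [mem_boxPairs_iff] at hxy
  obtain ⟨hx1, hx2, hy1, hy2, -⟩ := hxy
  have hN : (Ideal.absNorm (pairIdeal xy) : ℝ) = (xy.1 : ℝ) ^ 3 + 2 * (xy.2 : ℝ) ^ 3 := by
    rw [absNorm_pairIdeal]; push_cast; ring
  rw [hN]
  have hx2' : (xy.1 : ℝ) ≤ 2 * X := by nlinarith
  have hy2' : (xy.2 : ℝ) ≤ 2 * X := by nlinarith
  have hx0 : (0 : ℝ) ≤ xy.1 := Nat.cast_nonneg _
  have hy0 : (0 : ℝ) ≤ xy.2 := Nat.cast_nonneg _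
  constructor
  · have h1 : X ^ 3 < (xy.1 : ℝ) ^ 3 := by
      exact pow_lt_pow_left₀ hx1 hX.le (by norm_num)
    have h2 : (0 : ℝ) ≤ (xy.2 : ℝ) ^ 3 := by positivity
    linarith
  · have h1 : (xy.1 : ℝ) ^ 3 ≤ (2 * X) ^ 3 := pow_le_pow_left₀ hx0 hx2' 3
    have h2 : (xy.2 : ℝ) ^ 3 ≤ (2 * X) ^ 3 := pow_le_pow_left₀ hy0 hy2' 3
    nlinarith

/-- The members of `ℬ^(K)` have `3X³ < N ≤ 6X³` for `0 ≤ η ≤ 1`. [cite: HeathBrownActa2001, §3 p. 10] -/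
theorem absNorm_normWindow_bounds {X η : ℝ} (hX : 0 < X) (hη1 : η ≤ 1)
    {J : Ideal (𝓞 K)} (hJ : J ∈ normWindow X η) :
    X ^ 3 < (Ideal.absNorm J : ℝ) ∧ (Ideal.absNorm J : ℝ) ≤ 6 * X ^ 3 := by
  rw [mem_normWindow_iff] at hJ
  obtain ⟨h1, h2⟩ := hJ
  have hX3 : 0 < X ^ 3 := pow_pos hX 3
  constructor
  · linarith
  · nlinarith

/-! ### `S₄`: the bound from Lemma 7.1 for a general family -/

section S4Final

variable {ι : Type*} (E : Finset ι) (I : ι → Ideal (𝓞 K))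

/-- **`|S₄ − Ŝ₄|` from Lemma 7.1 for a general family.** With `h7` the conclusion of the corrected
Lemma 7.1 for the sifting functions of the family (main term `M`, error `Err`), `2^{15} ≤ X`,
`0 < τ ≤ 1/8`, `1/log X ≤ τ`, members `X³ < N(I_i) ≤ C_N X³` (`1 ≤ C_N < X^{3τ}`):
`|S₄ − Ŝ₄| ≤ ∑_{N(P)∉ℙ} #𝒵_P + ∑_{R₀∈D} #𝒵_{R₀} + C₇(20 + 10C₁)·τM/log X + 9C₇·Err·log X`
(edge windows of weight `≤ 2ξ + O(1/log X)` each by the sharp Mertens bound, the whole range of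
weight `≤ 1 + O(1/log X)` times the weight error `ξ`; `ξ ≤ τ`, `1/log X ≤ τ`).
[cite: HeathBrownActa2001, §7 p. 46] -/
theorem S4_bound_of_h7 {X τ CN C₇ M Err : ℝ} (hX : (2 : ℝ) ^ 15 ≤ X) (hτ : 0 < τ)
    (hτ1 : τ ≤ 1 / 8) (hlogτ : (Real.log X)⁻¹ ≤ τ) (hCN : CN < X ^ (3 * τ)) (hCN1 : 1 ≤ CN)
    (hE : ∀ i ∈ E, I i ≠ ⊥ ∧ X ^ 3 < (Ideal.absNorm (I i) : ℝ) ∧ (Ideal.absNorm (I i) : ℝ) ≤ CN * X ^ 3)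
    (D : Finset (Ideal (𝓞 K))) (hD0 : ∀ R₀ ∈ D, R₀ ≠ ⊥)
    (hD : ∀ R₀ : Ideal (𝓞 K), R₀.IsPrime → R₀ ≠ ⊥ → ¬ (Ideal.absNorm R₀).Prime →
      X ^ (1 + τ) ≤ (Ideal.absNorm R₀ : ℝ) → (Ideal.absNorm R₀ : ℝ) ≤ CN * X ^ 2 → R₀ ∈ D)
    (hC₇ : 0 ≤ C₇) (hM : 0 ≤ M) (hErr : 0 ≤ Err) {C₁ : ℝ} (hC₁ : 0 ≤ C₁)
    (hwin : ∀ (lo hi : ℝ) (T : Finset ℕ), 2 ≤ lo → lo ≤ hi →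
      (∀ p ∈ T, p.Prime ∧ lo < (p : ℝ) ∧ (p : ℝ) ≤ hi) →
      ∑ p ∈ T, (idealNormCount K p : ℝ) * (p : ℝ)⁻¹ ≤
        Real.log (Real.log hi / Real.log lo) + C₁ / Real.log lo)
    (h7 : ∀ (N z : ℝ) (𝒬 : Finset ℕ), X ^ τ ≤ z → 0 < N → N ≤ X ^ (2 - 2 * τ) →
        (∀ q ∈ 𝒬, Squarefree q ∧ N < q ∧ (q : ℝ) ≤ 2 * N) →
        ∑ Q ∈ normIn 𝒬, (famSifted E I Q z : ℝ) ≤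
          C₇ * (M / Real.log (min z (X ^ (2 - τ) / N)) *
            ∑ Q ∈ normIn 𝒬, ((Ideal.absNorm Q : ℕ) : ℝ)⁻¹ + Err)) :
    |(S₄ E I X τ : ℝ) - S4hat X τ E I| ≤
      ∑ P ∈ (primesNormIco (X ^ (1 + τ)) (X ^ (3 / 2 - τ))).filter
          (fun P => ¬ (Ideal.absNorm P).Prime), (famCount E I P : ℝ) +
      ∑ R₀ ∈ D, (famCount E I R₀ : ℝ) +
      C₇ * (20 + 10 * C₁) * (τ * M / Real.log X) + 9 * C₇ * Err * Real.log X := by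
  classical
  have hX1 : 1 < X := lt_of_lt_of_le (by norm_num) hX
  have hX0 : 0 < X := by linarith
  have hX4 : 4 ≤ X := le_trans (by norm_num) hX
  set L := Real.log X with hL
  have hL10 : 10 ≤ L := ten_le_log hX
  have hL0 : 0 < L := by linarith
  have hξ := hbXi_pos hτ
  have hξτ : hbXi τ ≤ τ := hbXi_le hτ.le (by linarith)
  have hLτ : 1 / L ≤ τ := by rw [one_div]; exact hlogτ
  have hbase := S4_abs_sub_le E I hX1 hτ hτ1 hCN hCN1 hE D hD0 hD
  set R := primesNormIco (X ^ (1 + τ)) (X ^ (3 / 2 - τ)) with hR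
  set z : ℝ := X ^ (1 / 2 : ℝ) with hz
  set b : ℝ := X ^ (3 / 2 - τ) with hb
  -- the dyadic data at level `z = X^{1/2}` on `[X^{1+τ}, X^{3/2−τ})`
  have ha2 : (2 : ℝ) ≤ X ^ (1 + τ) := by
    have : X ^ (1 : ℝ) ≤ X ^ (1 + τ) := Real.rpow_le_rpow_of_exponent_le hX1.le (by linarith)
    rw [Real.rpow_one] at this; linarith
  have hab : X ^ (1 + τ) ≤ b := Real.rpow_le_rpow_of_exponent_le hX1.le (by linarith)
  have hbX : b ≤ X ^ (2 - 2 * τ) := Real.rpow_le_rpow_of_exponent_le hX1.le (by linarith)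
  have hmin : min z (X ^ (2 - τ) / b) = z := by
    have : X ^ (2 - τ) / b = z := by
      rw [hb, hz, ← Real.rpow_sub hX0]; norm_num
    rw [this, min_self]
  have hz1 : 1 < z := Real.one_lt_rpow hX1 (by norm_num)
  have hm1 : 1 < min z (X ^ (2 - τ) / b) := by rw [hmin]; exact hz1
  have hlogz : Real.log (min z (X ^ (2 - τ) / b)) = L / 2 := by
    rw [hmin, hz, Real.log_rpow hX0]; ring
  have hτz : X ^ τ ≤ z := Real.rpow_le_rpow_of_exponent_le hX1.le (by linarith)
  have h7z : ∀ (N : ℝ) (𝒬 : Finset ℕ), 0 < N → N ≤ X ^ (2 - 2 * τ) →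
      (∀ q ∈ 𝒬, Squarefree q ∧ N < q ∧ (q : ℝ) ≤ 2 * N) →
      ∑ Q ∈ normIn 𝒬, (famSifted E I Q z : ℝ) ≤
        C₇ * (M / Real.log (min z (X ^ (2 - τ) / N)) *
          ∑ Q ∈ normIn 𝒬, ((Ideal.absNorm Q : ℕ) : ℝ)⁻¹ + Err) :=
    fun N 𝒬 hN hNX h𝒬 => h7 N z 𝒬 hτz hN hNX h𝒬
  have hblocks : Real.log b / Real.log 2 + 1 ≤ 3 * L := by
    refine log_div_log_two_add_one_le ?_ ?_ hL hL10
    · exact Real.one_le_rpow hX1.le (by linarith)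
    · calc b ≤ X ^ ((2 : ℕ) : ℝ) := Real.rpow_le_rpow_of_exponent_le hX1.le (by norm_num; linarith)
        _ = X ^ 2 := Real.rpow_natCast X 2
  -- the generic estimate for a sub-family `T ⊆ {P ∈ R : N(P) prime}` with window weight `W`
  have hfam : ∀ (T : Finset (Ideal (𝓞 K))) (W : ℝ), T ⊆ R.filter (fun P => (Ideal.absNorm P).Prime) →
      ∑ q ∈ T.image Ideal.absNorm, (idealNormCount K q : ℝ) * (q : ℝ)⁻¹ ≤ W →
      ∑ P ∈ T, (famSifted E I P z : ℝ) ≤ C₇ * (2 * M / L) * W + 3 * L * (C₇ * Err) := by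
    intro T W hT hW
    have hT' : ∀ Q ∈ T, Squarefree (Ideal.absNorm Q) ∧ X ^ (1 + τ) ≤ (Ideal.absNorm Q : ℝ) ∧
        (Ideal.absNorm Q : ℝ) < b := by
      intro Q hQ
      have h := hT hQ
      rw [mem_filter, hR, mem_primesNormIco_iff] at h
      exact ⟨h.2.prime.squarefree, h.1.2.2.1, h.1.2.2.2⟩
    have h := sum_le_of_image_normIn (fun Q => Nat.cast_nonneg _) h7z hC₇ hM hErr hX0 ha2 hab hbX hm1 T hT'
    rw [hlogz] at h
    have hMW : C₇ * (M / (L / 2) * ∑ q ∈ T.image Ideal.absNorm, (idealNormCount K q : ℝ) * (q : ℝ)⁻¹) ≤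
        C₇ * (2 * M / L) * W := by
      have : M / (L / 2) = 2 * M / L := by field_simp
      rw [this, ← mul_assoc]
      exact mul_le_mul_of_nonneg_left hW (by positivity)
    have hEW : (Real.log b / Real.log 2 + 1) * (C₇ * Err) ≤ 3 * L * (C₇ * Err) :=
      mul_le_mul_of_nonneg_right hblocks (by positivity)
    linarith
  -- the three families
  set T₁ := R.filter (fun P => (Ideal.absNorm P).Prime ∧ (Ideal.absNorm P : ℝ) < X ^ (1 + τ + hbXi τ)) with hT₁
  set T₂ := R.filter (fun P => (Ideal.absNorm P).Prime ∧ X ^ (3 / 2 - τ - hbXi τ) ≤ (Ideal.absNorm P : ℝ)) with hT₂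
  set T₃ := R.filter (fun P => (Ideal.absNorm P).Prime) with hT₃
  have hsub₁ : T₁ ⊆ T₃ := monotone_filter_right _ fun P _ h => h.1
  have hsub₂ : T₂ ⊆ T₃ := monotone_filter_right _ fun P _ h => h.1
  have hW₁ := window_normWt_le hC₁ hwin hX4 (θ := 1 + τ) (δ := hbXi τ) (by linarith) hξ.le T₁ (by
    intro Q hQ
    rw [hT₁, mem_filter, hR, mem_primesNormIco_iff] at hQ
    exact ⟨hQ.2.1, hQ.1.2.2.1, by rw [show 1 + τ + hbXi τ = 1 + τ + hbXi τ from rfl]; exact hQ.2.2⟩)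
  have hW₂ := window_normWt_le hC₁ hwin hX4 (θ := 3 / 2 - τ - hbXi τ) (δ := hbXi τ) (by linarith) hξ.le T₂ (by
    intro Q hQ
    rw [hT₂, mem_filter, hR, mem_primesNormIco_iff] at hQ
    refine ⟨hQ.2.1, hQ.2.2, ?_⟩
    rw [show 3 / 2 - τ - hbXi τ + hbXi τ = 3 / 2 - τ by ring]
    exact hQ.1.2.2.2)
  have hW₃ := window_normWt_le hC₁ hwin hX4 (θ := 1 + τ) (δ := 1 / 2 - 2 * τ) (by linarith) (by linarith) T₃ (by
    intro Q hQ
    rw [hT₃, mem_filter, hR, mem_primesNormIco_iff] at hQ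
    refine ⟨hQ.2, hQ.1.2.2.1, ?_⟩
    rw [show 1 + τ + (1 / 2 - 2 * τ) = 3 / 2 - τ by ring]
    exact hQ.1.2.2.2)
  have hS₁ := hfam T₁ _ hsub₁ hW₁
  have hS₂ := hfam T₂ _ hsub₂ hW₂
  have hS₃ := hfam T₃ _ subset_rfl hW₃
  -- the edge-window sum is at most the sum of the two window sums
  have hedge : ∑ P ∈ R.filter (fun P => (Ideal.absNorm P).Prime ∧ ((Ideal.absNorm P : ℝ) < X ^ (1 + τ + hbXi τ) ∨
        X ^ (3 / 2 - τ - hbXi τ) ≤ (Ideal.absNorm P : ℝ))), (famSifted E I P z : ℝ) ≤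
      ∑ P ∈ T₁, (famSifted E I P z : ℝ) + ∑ P ∈ T₂, (famSifted E I P z : ℝ) := by
    calc _ ≤ ∑ P ∈ T₁ ∪ T₂, (famSifted E I P z : ℝ) := by
          refine sum_le_sum_of_subset_of_nonneg (fun P hP => ?_) fun _ _ _ => Nat.cast_nonneg _
          rw [mem_filter] at hP
          rw [mem_union, hT₁, hT₂, mem_filter, mem_filter]
          rcases hP.2.2 with h | h
          · exact Or.inl ⟨hP.1, hP.2.1, h⟩
          · exact Or.inr ⟨hP.1, hP.2.1, h⟩
      _ ≤ _ := sum_union_le_add T₁ T₂ fun _ => Nat.cast_nonneg _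
  -- arithmetic
  have hlog2 : Real.log 2 ≤ 1 := by
    have := Real.log_two_lt_d9; linarith
  have hε : 2 * (Real.log 2 + C₁) / L ≤ 2 * (1 + C₁) * τ := by
    calc 2 * (Real.log 2 + C₁) / L ≤ 2 * (1 + C₁) / L := by gcongr
      _ = 2 * (1 + C₁) * (1 / L) := by ring
      _ ≤ 2 * (1 + C₁) * τ := mul_le_mul_of_nonneg_left hLτ (by positivity)
  have hMpos : 0 ≤ C₇ * (2 * M / L) := by positivity
  have hE0 : 0 ≤ 3 * L * (C₇ * Err) := by positivity
  -- windows
  have hwin_tot : ∑ P ∈ T₁, (famSifted E I P z : ℝ) + ∑ P ∈ T₂, (famSifted E I P z : ℝ) ≤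
      C₇ * (2 * M / L) * (2 * (4 + 2 * C₁) * τ) + 6 * L * (C₇ * Err) := by
    have h1 : 2 * hbXi τ + 2 * (Real.log 2 + C₁) / L ≤ (4 + 2 * C₁) * τ := by linarith
    have e1 : C₇ * (2 * M / L) * (2 * hbXi τ + 2 * (Real.log 2 + C₁) / L) ≤
        C₇ * (2 * M / L) * ((4 + 2 * C₁) * τ) := mul_le_mul_of_nonneg_left h1 hMpos
    linarith
  -- the weight term
  have hwt_tot : hbXi τ * ∑ P ∈ T₃, (famSifted E I P z : ℝ) ≤
      C₇ * (2 * M / L) * ((2 + C₁) * τ) + 3 * L * (C₇ * Err) := by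
    have h1 : 2 * (1 / 2 - 2 * τ) + 2 * (Real.log 2 + C₁) / L ≤ 1 + 2 * (1 + C₁) * τ := by linarith
    have hS₃' : ∑ P ∈ T₃, (famSifted E I P z : ℝ) ≤
        C₇ * (2 * M / L) * (1 + 2 * (1 + C₁) * τ) + 3 * L * (C₇ * Err) := by
      have := mul_le_mul_of_nonneg_left h1 hMpos
      linarith
    have hsum0 : 0 ≤ ∑ P ∈ T₃, (famSifted E I P z : ℝ) := sum_nonneg fun _ _ => Nat.cast_nonneg _
    have hξ1 : hbXi τ ≤ 1 := by linarith
    have hA : hbXi τ * (1 + 2 * (1 + C₁) * τ) ≤ (2 + C₁) * τ := by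
      have h1 : hbXi τ * (1 + 2 * (1 + C₁) * τ) ≤ τ * (1 + 2 * (1 + C₁) * τ) :=
        mul_le_mul_of_nonneg_right hξτ (by positivity)
      have h2' : 2 * (1 + C₁) * τ ≤ 2 * (1 + C₁) * (1 / 8) :=
        mul_le_mul_of_nonneg_left hτ1 (by positivity)
      have h2 : τ * (1 + 2 * (1 + C₁) * τ) ≤ τ * (1 + 2 * (1 + C₁) * (1 / 8)) :=
        mul_le_mul_of_nonneg_left (by linarith) hτ.le
      have h3 : τ * (1 + 2 * (1 + C₁) * (1 / 8)) = (5 / 4 + C₁ / 4) * τ := by ring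
      have h4 : (5 / 4 + C₁ / 4) * τ ≤ (2 + C₁) * τ := mul_le_mul_of_nonneg_right (by linarith) hτ.le
      linarith
    have hB : hbXi τ * (3 * L * (C₇ * Err)) ≤ 3 * L * (C₇ * Err) := by
      calc hbXi τ * (3 * L * (C₇ * Err)) ≤ 1 * (3 * L * (C₇ * Err)) :=
            mul_le_mul_of_nonneg_right hξ1 hE0
        _ = _ := one_mul _
    calc hbXi τ * ∑ P ∈ T₃, (famSifted E I P z : ℝ)
        ≤ hbXi τ * (C₇ * (2 * M / L) * (1 + 2 * (1 + C₁) * τ) + 3 * L * (C₇ * Err)) :=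
          mul_le_mul_of_nonneg_left hS₃' hξ.le
      _ = C₇ * (2 * M / L) * (hbXi τ * (1 + 2 * (1 + C₁) * τ)) + hbXi τ * (3 * L * (C₇ * Err)) := by ring
      _ ≤ C₇ * (2 * M / L) * ((2 + C₁) * τ) + 3 * L * (C₇ * Err) :=
          add_le_add (mul_le_mul_of_nonneg_left hA hMpos) hB
  -- combine
  have h2 := hedge.trans hwin_tot
  calc _ ≤ _ := hbase
    _ ≤ ∑ P ∈ R.filter (fun P => ¬ (Ideal.absNorm P).Prime), (famCount E I P : ℝ) +
          (C₇ * (2 * M / L) * (2 * (4 + 2 * C₁) * τ) + 6 * L * (C₇ * Err)) +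
          ∑ R₀ ∈ D, (famCount E I R₀ : ℝ) +
          (C₇ * (2 * M / L) * ((2 + C₁) * τ) + 3 * L * (C₇ * Err)) :=
        add_le_add (add_le_add (add_le_add le_rfl h2) le_rfl) hwt_tot
    _ = _ := by ring

/-! ### `S₄` for `𝒜^(K)` and `ℬ^(K)` -/

/-- **Lemma 3.7 for `S₄(𝒜)` from the corrected Lemma 7.1**:
`|S₄(𝒜) − Ŝ₄(𝒜)| ≤ C ξτ^{-4} η²X²/log X` for `X ≥ X₀`, `η` in (2.1) (in fact `O(ξ η²X²/log X)`;
`ξτ^{-4} = τ` is the common scale of Lemma 3.7). For `𝒜^(K)` the degree-`≥ 2` terms vanish by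
Lemma 3.1. [cite: HeathBrownActa2001, Lemma 3.7] -/
theorem S4_A_bound (h71 : HeathBrown2001_lemma_7_1_normWeighted) {ϖ : ℝ} (hϖ0 : 0 < ϖ)
    (hϖ1 : ϖ < 1 / 5) :
    ∃ C X₀ : ℝ, ∀ X η : ℝ, X₀ ≤ X → Real.exp (-Real.log X ^ (1 / 3 : ℝ)) ≤ η → η ≤ 1 →
      |(S₄ (boxPairs X η) pairIdeal X (hbTau ϖ X) : ℝ) - S4hat X (hbTau ϖ X) (boxPairs X η) pairIdeal| ≤
        C * (hbXi (hbTau ϖ X) / hbTau ϖ X ^ 4) * (η ^ 2 * X ^ 2 / Real.log X) := by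
  classical
  obtain ⟨C₇, X₇, h7⟩ := h71 ϖ hϖ0 hϖ1
  obtain ⟨C₁, hC₁, hwin⟩ := exists_sum_normWt_window_le
  have hϖ1' : ϖ ≤ 1 := by linarith
  set C₇' : ℝ := max C₇ 1 with hC₇'
  have hC₇'0 : 0 ≤ C₇' := le_trans zero_le_one (le_max_right _ _)
  have hCC : C₇ ≤ C₇' := le_max_left _ _
  obtain ⟨X₁, hX₁⟩ := Filter.eventually_atTop.mp
    ((eventually_upperBound_params hϖ0 hϖ1' one_pos 3).and
      ((eventually_le_hbTau_mul_log hϖ1' 4).and (eventually_ge_atTop (max X₇ ((2 : ℝ) ^ 15)))))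
  refine ⟨C₇' * (29 + 10 * C₁), X₁, fun X η hX hη hη1 => ?_⟩
  obtain ⟨⟨-, hτ0, hτ8, hlogτ, habs⟩, hτL, hXmax⟩ := hX₁ X hX
  set τ := hbTau ϖ X with hτdef
  have hX15 : (2 : ℝ) ^ 15 ≤ X := le_trans (le_max_right _ _) hXmax
  have hX7 : X₇ ≤ X := le_trans (le_max_left _ _) hXmax
  have hX1 : 1 < X := lt_of_lt_of_le (by norm_num) hX15
  have hX0 : 0 < X := by linarith
  set L := Real.log X with hL
  have hL10 : 10 ≤ L := ten_le_log hX15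
  have hη0 : 0 < η := lt_of_lt_of_le (Real.exp_pos _) hη
  -- members of `𝒜^(K)`
  have hE : ∀ xy ∈ boxPairs X η, pairIdeal xy ≠ ⊥ ∧ X ^ 3 < (Ideal.absNorm (pairIdeal xy) : ℝ) ∧
      (Ideal.absNorm (pairIdeal xy) : ℝ) ≤ 24 * X ^ 3 := fun xy hxy =>
    ⟨pairIdeal_ne_bot_of_mem_boxPairs hX0.le xy hxy, absNorm_pairIdeal_bounds hX0 hη1 hxy⟩
  -- `24 < X^{3τ}` from `τ log X ≥ 4`
  have hCN : (24 : ℝ) < X ^ (3 * τ) := by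
    have h1 : Real.exp 12 ≤ X ^ (3 * τ) := by
      rw [Real.rpow_def_of_pos hX0, ← hL]
      exact Real.exp_le_exp.mpr (by nlinarith)
    have h2 : (24 : ℝ) < Real.exp 12 := by
      have he : (2 : ℝ) < Real.exp 1 := by have := Real.exp_one_gt_d9; linarith
      have h3 : Real.exp 12 = Real.exp 1 ^ 12 := by
        rw [← Real.exp_nat_mul]; norm_num
      rw [h3]
      calc (24 : ℝ) < 2 ^ 12 := by norm_num
        _ ≤ Real.exp 1 ^ 12 := pow_le_pow_left₀ (by norm_num) he.le 12
    linarith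
  set D := (Literature.NumberTheory.LFunctions.NumberField.finite_primeIdealsLE K (24 * X ^ 2)).toFinset.filter
    fun R₀ => ¬ (Ideal.absNorm R₀).Prime ∧ X ^ (1 + τ) ≤ (Ideal.absNorm R₀ : ℝ) with hD
  have hDmem : ∀ R₀ ∈ D, R₀.IsPrime ∧ R₀ ≠ ⊥ ∧ ¬ (Ideal.absNorm R₀).Prime := by
    intro R₀ hR₀
    simp only [hD, mem_filter, Set.Finite.mem_toFinset,
      Literature.NumberTheory.LFunctions.NumberField.primeIdealsLE, Set.mem_setOf_eq] at hR₀
    exact ⟨hR₀.1.1, hR₀.1.2.1, hR₀.2.1⟩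
  have hD0 : ∀ R₀ ∈ D, R₀ ≠ ⊥ := fun R₀ hR₀ => (hDmem R₀ hR₀).2.1
  have hDin : ∀ R₀ : Ideal (𝓞 K), R₀.IsPrime → R₀ ≠ ⊥ → ¬ (Ideal.absNorm R₀).Prime →
      X ^ (1 + τ) ≤ (Ideal.absNorm R₀ : ℝ) → (Ideal.absNorm R₀ : ℝ) ≤ 24 * X ^ 2 → R₀ ∈ D := by
    intro R₀ h1 h2 h3 h4 h5
    simp only [hD, mem_filter, Set.Finite.mem_toFinset,
      Literature.NumberTheory.LFunctions.NumberField.primeIdealsLE, Set.mem_setOf_eq]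
    exact ⟨⟨h1, h2, h5⟩, h3, h4⟩
  -- Lemma 7.1 for `𝒜`
  have h7A : ∀ (N z : ℝ) (𝒬 : Finset ℕ), X ^ τ ≤ z → 0 < N → N ≤ X ^ (2 - 2 * τ) →
      (∀ q ∈ 𝒬, Squarefree q ∧ N < q ∧ (q : ℝ) ≤ 2 * N) →
      ∑ Q ∈ normIn 𝒬, (famSifted (boxPairs X η) pairIdeal Q z : ℝ) ≤
        C₇' * (η ^ 2 * X ^ 2 / Real.log (min z (X ^ (2 - τ) / N)) *
          ∑ Q ∈ normIn 𝒬, ((Ideal.absNorm Q : ℕ) : ℝ)⁻¹ + X ^ (2 - τ / 5)) := by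
    intro N z 𝒬 hz hN hNX h𝒬
    have h := (h7 X η hX7 hη hη1 N z 𝒬 hz hN hNX h𝒬).1
    simp_rw [siftedA_eq_famSifted] at h
    refine h.trans (mul_le_mul_of_nonneg_right hCC ?_)
    have hlogmin : 0 ≤ Real.log (min z (X ^ (2 - τ) / N)) := by
      refine Real.log_nonneg ?_
      have hz1 : 1 ≤ z := le_trans (Real.one_le_rpow hX1.le hτ0.le) hz
      have h2 : 1 ≤ X ^ (2 - τ) / N := by
        rw [le_div_iff₀ hN, one_mul]
        exact hNX.trans (Real.rpow_le_rpow_of_exponent_le hX1.le (by linarith))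
      exact le_min hz1 h2
    have : 0 ≤ ∑ Q ∈ normIn 𝒬, ((Ideal.absNorm Q : ℕ) : ℝ)⁻¹ := sum_nonneg fun _ _ => by positivity
    positivity
  have hmain := S4_bound_of_h7 (boxPairs X η) pairIdeal hX15 hτ0 hτ8 hlogτ hCN (by norm_num) hE D hD0 hDin
    hC₇'0 (by positivity) (by positivity) hC₁ hwin h7A
  -- the degree-`≥ 2` terms vanish for `𝒜`
  have hT1 : ∑ P ∈ (primesNormIco (X ^ (1 + τ)) (X ^ (3 / 2 - τ))).filter
      (fun P => ¬ (Ideal.absNorm P).Prime), (famCount (boxPairs X η) pairIdeal P : ℝ) = 0 := by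
    refine sum_eq_zero fun P hP => ?_
    rw [mem_filter, mem_primesNormIco_iff] at hP
    rw [famCount_boxPairs, countA_eq_zero_of_not_prime hP.1.1 hP.1.2.1 (dvd_refl P) hP.2, Nat.cast_zero]
  have hT3 : ∑ R₀ ∈ D, (famCount (boxPairs X η) pairIdeal R₀ : ℝ) = 0 := by
    refine sum_eq_zero fun R₀ hR₀ => ?_
    obtain ⟨h1, h2, h3⟩ := hDmem R₀ hR₀
    rw [famCount_boxPairs, countA_eq_zero_of_not_prime h1 h2 (dvd_refl R₀) h3, Nat.cast_zero]
  rw [hT1, hT3, zero_add, zero_add] at hmain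
  -- absorb the error term
  have hη2 : Real.exp (-2 * Real.log X ^ (1 / 3 : ℝ)) ≤ η ^ 2 := by
    have : Real.exp (-2 * Real.log X ^ (1 / 3 : ℝ)) = Real.exp (-Real.log X ^ (1 / 3 : ℝ)) ^ 2 := by
      rw [← Real.exp_nat_mul]; ring_nf
    rw [this]
    exact pow_le_pow_left₀ (Real.exp_pos _).le hη 2
  have habs' : X ^ (-τ / 5) * L ^ 3 ≤ τ * η ^ 2 / L := by
    rw [one_mul] at habs
    refine habs.trans ?_
    rw [hL]
    exact div_le_div_of_nonneg_right (mul_le_mul_of_nonneg_left hη2 hτ0.le) (by linarith)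
  have herr : 9 * C₇' * X ^ (2 - τ / 5) * L ≤ 9 * C₇' * (τ * η ^ 2 * X ^ 2 / L) := by
    have h := absorb_le (T := 9 * C₇') (δ := τ / 5) (j := 1) hX1.le (by linarith) (by positivity)
      le_rfl (by norm_num) habs'
    have e : X ^ (2 - τ / 5) = X ^ 2 * X ^ (-(τ / 5)) := rpow_two_sub hX0 (τ / 5)
    rw [pow_one] at h
    calc 9 * C₇' * X ^ (2 - τ / 5) * L = 9 * C₇' * (X ^ 2 * X ^ (-(τ / 5)) * L) := by rw [e]; ring
      _ ≤ _ := h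
  have hscale : hbXi τ / τ ^ 4 = τ := hbXi_div_pow_four hτ0.ne'
  rw [hscale]
  have hfinal : C₇' * (20 + 10 * C₁) * (τ * (η ^ 2 * X ^ 2) / L) + 9 * C₇' * (τ * η ^ 2 * X ^ 2 / L) =
      C₇' * (29 + 10 * C₁) * τ * (η ^ 2 * X ^ 2 / L) := by ring
  calc _ ≤ C₇' * (20 + 10 * C₁) * (τ * (η ^ 2 * X ^ 2) / L) + 9 * C₇' * X ^ (2 - τ / 5) * L := hmain
    _ ≤ C₇' * (20 + 10 * C₁) * (τ * (η ^ 2 * X ^ 2) / L) + 9 * C₇' * (τ * η ^ 2 * X ^ 2 / L) := by linarith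
    _ = C₇' * (29 + 10 * C₁) * τ * (η ^ 2 * X ^ 2 / L) := hfinal

/-- **Lemma 3.7 for `S₄(ℬ)` from the corrected Lemma 7.1**:
`|S₄(ℬ) − Ŝ₄(ℬ)| ≤ C ξτ^{-4} ηX³/log X` for `X ≥ X₀`, `η` in (2.1). For `ℬ^(K)` the prime ideals of
degree `≥ 2` contribute through `#ℬ^(K)_R ≪ X³/N(R)` ((7.7)): the unmatched ones
`≪ X³ ∑_{N(P) ≥ X^{1+τ}, N(P)∉ℙ} N(P)^{-1} ≪ X^{3−1/3}`, the cofactors of degree `≥ 2`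
`≪ X · X³/X^{1+τ}`. [cite: HeathBrownActa2001, Lemma 3.7] -/
theorem S4_B_bound (h71 : HeathBrown2001_lemma_7_1_normWeighted) {ϖ : ℝ} (hϖ0 : 0 < ϖ)
    (hϖ1 : ϖ < 1 / 5) :
    ∃ C X₀ : ℝ, ∀ X η : ℝ, X₀ ≤ X → Real.exp (-Real.log X ^ (1 / 3 : ℝ)) ≤ η → η ≤ 1 →
      |(S₄ (normWindow X η) (fun J => J) X (hbTau ϖ X) : ℝ) -
          S4hat X (hbTau ϖ X) (normWindow X η) (fun J => J)| ≤
        C * (hbXi (hbTau ϖ X) / hbTau ϖ X ^ 4) * (η * X ^ 3 / Real.log X) := by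
  classical
  obtain ⟨C₇, X₇, h7⟩ := h71 ϖ hϖ0 hϖ1
  obtain ⟨C₁, hC₁, hwin⟩ := exists_sum_normWt_window_le
  obtain ⟨C_B, hCB, hcountB⟩ := exists_countB_le
  have hϖ1' : ϖ ≤ 1 := by linarith
  set C₇' : ℝ := max C₇ 1 with hC₇'
  have hC₇'0 : 0 ≤ C₇' := le_trans zero_le_one (le_max_right _ _)
  have hCC : C₇ ≤ C₇' := le_max_left _ _
  obtain ⟨X₁, hX₁⟩ := Filter.eventually_atTop.mp
    ((eventually_upperBound_params hϖ0 hϖ1' one_pos 3).and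
      ((eventually_le_hbTau_mul_log hϖ1' 4).and (eventually_ge_atTop (max X₇ ((2 : ℝ) ^ 15)))))
  refine ⟨C₇' * (29 + 10 * C₁) + 20 * C_B, X₁, fun X η hX hη hη1 => ?_⟩
  obtain ⟨⟨-, hτ0, hτ8, hlogτ, habs⟩, hτL, hXmax⟩ := hX₁ X hX
  set τ := hbTau ϖ X with hτdef
  have hX15 : (2 : ℝ) ^ 15 ≤ X := le_trans (le_max_right _ _) hXmax
  have hX7 : X₇ ≤ X := le_trans (le_max_left _ _) hXmax
  have hX1 : 1 < X := lt_of_lt_of_le (by norm_num) hX15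
  have hX0 : 0 < X := by linarith
  have hX16 : (16 : ℝ) ≤ X := le_trans (by norm_num) hX15
  set L := Real.log X with hL
  have hL10 : 10 ≤ L := ten_le_log hX15
  have hη0 : 0 < η := lt_of_lt_of_le (Real.exp_pos _) hη
  set E := normWindow X η with hE'
  -- members of `ℬ^(K)`
  have hE : ∀ J ∈ E, (fun J : Ideal (𝓞 K) => J) J ≠ ⊥ ∧ X ^ 3 < (Ideal.absNorm ((fun J : Ideal (𝓞 K) => J) J) : ℝ) ∧
      (Ideal.absNorm ((fun J : Ideal (𝓞 K) => J) J) : ℝ) ≤ 6 * X ^ 3 := fun J hJ =>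
    ⟨ne_bot_of_mem_normWindow hX0.le J hJ, absNorm_normWindow_bounds hX0 hη1 hJ⟩
  have hCN : (6 : ℝ) < X ^ (3 * τ) := by
    have h1 : Real.exp 12 ≤ X ^ (3 * τ) := by
      rw [Real.rpow_def_of_pos hX0, ← hL]
      exact Real.exp_le_exp.mpr (by nlinarith)
    have h2 : (6 : ℝ) < Real.exp 12 := by
      have := Real.add_one_le_exp (12 : ℝ); linarith
    linarith
  set D := (Literature.NumberTheory.LFunctions.NumberField.finite_primeIdealsLE K (6 * X ^ 2)).toFinset.filter
    fun R₀ => ¬ (Ideal.absNorm R₀).Prime ∧ X ^ (1 + τ) ≤ (Ideal.absNorm R₀ : ℝ) with hD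
  have hDmem : ∀ R₀ ∈ D, R₀.IsPrime ∧ R₀ ≠ ⊥ ∧ ¬ (Ideal.absNorm R₀).Prime ∧
      X ^ (1 + τ) ≤ (Ideal.absNorm R₀ : ℝ) := by
    intro R₀ hR₀
    simp only [hD, mem_filter, Set.Finite.mem_toFinset,
      Literature.NumberTheory.LFunctions.NumberField.primeIdealsLE, Set.mem_setOf_eq] at hR₀
    exact ⟨hR₀.1.1, hR₀.1.2.1, hR₀.2.1, hR₀.2.2⟩
  have hD0 : ∀ R₀ ∈ D, R₀ ≠ ⊥ := fun R₀ hR₀ => (hDmem R₀ hR₀).2.1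
  have hDin : ∀ R₀ : Ideal (𝓞 K), R₀.IsPrime → R₀ ≠ ⊥ → ¬ (Ideal.absNorm R₀).Prime →
      X ^ (1 + τ) ≤ (Ideal.absNorm R₀ : ℝ) → (Ideal.absNorm R₀ : ℝ) ≤ 6 * X ^ 2 → R₀ ∈ D := by
    intro R₀ h1 h2 h3 h4 h5
    simp only [hD, mem_filter, Set.Finite.mem_toFinset,
      Literature.NumberTheory.LFunctions.NumberField.primeIdealsLE, Set.mem_setOf_eq]
    exact ⟨⟨h1, h2, h5⟩, h3, h4⟩
  -- Lemma 7.1 for `ℬ`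
  have h7B : ∀ (N z : ℝ) (𝒬 : Finset ℕ), X ^ τ ≤ z → 0 < N → N ≤ X ^ (2 - 2 * τ) →
      (∀ q ∈ 𝒬, Squarefree q ∧ N < q ∧ (q : ℝ) ≤ 2 * N) →
      ∑ Q ∈ normIn 𝒬, (famSifted E (fun J => J) Q z : ℝ) ≤
        C₇' * (η * X ^ 3 / Real.log (min z (X ^ (2 - τ) / N)) *
          ∑ Q ∈ normIn 𝒬, ((Ideal.absNorm Q : ℕ) : ℝ)⁻¹ + X ^ (3 - τ / 5)) := by
    intro N z 𝒬 hz hN hNX h𝒬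
    have h := (h7 X η hX7 hη hη1 N z 𝒬 hz hN hNX h𝒬).2
    simp_rw [siftedB_eq_famSifted] at h
    refine h.trans (mul_le_mul_of_nonneg_right hCC ?_)
    have hlogmin : 0 ≤ Real.log (min z (X ^ (2 - τ) / N)) := by
      refine Real.log_nonneg ?_
      have hz1 : 1 ≤ z := le_trans (Real.one_le_rpow hX1.le hτ0.le) hz
      have h2 : 1 ≤ X ^ (2 - τ) / N := by
        rw [le_div_iff₀ hN, one_mul]
        exact hNX.trans (Real.rpow_le_rpow_of_exponent_le hX1.le (by linarith))
      exact le_min hz1 h2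
    have : 0 ≤ ∑ Q ∈ normIn 𝒬, ((Ideal.absNorm Q : ℕ) : ℝ)⁻¹ := sum_nonneg fun _ _ => by positivity
    positivity
  have hmain := S4_bound_of_h7 E (fun J => J) hX15 hτ0 hτ8 hlogτ hCN (by norm_num) hE D hD0 hDin
    hC₇'0 (by positivity) (by positivity) hC₁ hwin h7B
  -- (7.7) for the two degree-`≥ 2` terms
  have hcount : ∀ R : Ideal (𝓞 K), R ≠ ⊥ → (famCount E (fun J => J) R : ℝ) ≤ C_B * X ^ 3 / Ideal.absNorm R := by
    intro R hR
    rw [hE', famCount_normWindow]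
    exact hcountB X η hX0.le hη0.le hη1 R hR
  have hX1τ : 0 < X ^ (1 + τ) := Real.rpow_pos_of_pos hX0 _
  have hXle : X ≤ X ^ (1 + τ) := by
    have : X ^ (1 : ℝ) ≤ X ^ (1 + τ) := Real.rpow_le_rpow_of_exponent_le hX1.le (by linarith)
    rwa [Real.rpow_one] at this
  -- term 1: unmatched primes of degree ≥ 2
  have hT1 : ∑ P ∈ (primesNormIco (X ^ (1 + τ)) (X ^ (3 / 2 - τ))).filter
      (fun P => ¬ (Ideal.absNorm P).Prime), (famCount E (fun J => J) P : ℝ) ≤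
      8 * C_B * (X ^ 3 * X ^ (-(1 / 3 : ℝ))) := by
    set S := (primesNormIco (X ^ (1 + τ)) (X ^ (3 / 2 - τ))).filter
      (fun P => ¬ (Ideal.absNorm P).Prime) with hS
    have hSmem : ∀ P ∈ S, P.IsPrime ∧ P ≠ ⊥ ∧ ¬ (Ideal.absNorm P).Prime ∧ X ^ (1 + τ) / 2 < (Ideal.absNorm P : ℝ) := by
      intro P hP
      rw [hS, mem_filter, mem_primesNormIco_iff] at hP
      refine ⟨hP.1.1, hP.1.2.1, hP.2, ?_⟩
      linarith [hP.1.2.2.1]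
    have hY : (8 : ℝ) ≤ X ^ (1 + τ) / 2 := by linarith
    have hrec := sum_inv_absNorm_nonprime_le hY S hSmem
    have step1 : ∑ P ∈ S, (famCount E (fun J => J) P : ℝ) ≤ C_B * X ^ 3 * ∑ P ∈ S, ((Ideal.absNorm P : ℕ) : ℝ)⁻¹ := by
      rw [mul_sum]
      refine sum_le_sum fun P hP => ?_
      have h := hcount P (hSmem P hP).2.1
      rw [div_eq_mul_inv] at h
      exact h
    -- `6/(X^{1+τ}/2)^{1/3} ≤ 8 X^{-1/3}`
    have hY0 : 0 < X ^ (1 + τ) / 2 := by positivity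
    have step2 : 6 / (X ^ (1 + τ) / 2) ^ (1 / 3 : ℝ) ≤ 8 * X ^ (-(1 / 3 : ℝ)) := by
      have h1 : (X / 2) ^ (1 / 3 : ℝ) ≤ (X ^ (1 + τ) / 2) ^ (1 / 3 : ℝ) :=
        Real.rpow_le_rpow (by positivity) (by linarith) (by norm_num)
      have h2 : (X / 2) ^ (1 / 3 : ℝ) = X ^ (1 / 3 : ℝ) / 2 ^ (1 / 3 : ℝ) :=
        Real.div_rpow hX0.le (by norm_num) _
      have h3 : (2 : ℝ) ^ (1 / 3 : ℝ) ≤ 4 / 3 := by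
        have h4 : ((2 : ℝ) ^ (1 / 3 : ℝ)) ^ 3 = 2 := by
          rw [← Real.rpow_natCast, ← Real.rpow_mul (by norm_num)]; norm_num
        by_contra hcon
        push Not at hcon
        have h5 : ((4 : ℝ) / 3) ^ 3 < ((2 : ℝ) ^ (1 / 3 : ℝ)) ^ 3 :=
          pow_lt_pow_left₀ hcon (by norm_num) (by norm_num)
        rw [h4] at h5
        norm_num at h5
      have hX13 : 0 < X ^ (1 / 3 : ℝ) := Real.rpow_pos_of_pos hX0 _
      have h5 : X ^ (1 / 3 : ℝ) / (4 / 3) ≤ (X / 2) ^ (1 / 3 : ℝ) := by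
        rw [h2]; exact div_le_div_of_nonneg_left hX13.le (by positivity) h3
      have h6 : X ^ (1 / 3 : ℝ) / (4 / 3) ≤ (X ^ (1 + τ) / 2) ^ (1 / 3 : ℝ) := h5.trans h1
      have h7 : 0 < X ^ (1 / 3 : ℝ) / (4 / 3) := by positivity
      calc 6 / (X ^ (1 + τ) / 2) ^ (1 / 3 : ℝ) ≤ 6 / (X ^ (1 / 3 : ℝ) / (4 / 3)) :=
            div_le_div_of_nonneg_left (by norm_num) h7 h6
        _ = 8 * (X ^ (1 / 3 : ℝ))⁻¹ := by field_simp; ring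
        _ = 8 * X ^ (-(1 / 3 : ℝ)) := by rw [Real.rpow_neg hX0.le]
    calc ∑ P ∈ S, (famCount E (fun J => J) P : ℝ) ≤ C_B * X ^ 3 * ∑ P ∈ S, ((Ideal.absNorm P : ℕ) : ℝ)⁻¹ := step1
      _ ≤ C_B * X ^ 3 * (8 * X ^ (-(1 / 3 : ℝ))) :=
          mul_le_mul_of_nonneg_left (hrec.trans step2) (by positivity)
      _ = 8 * C_B * (X ^ 3 * X ^ (-(1 / 3 : ℝ))) := by ring
  -- term 3: cofactors of degree ≥ 2
  have hT3 : ∑ R₀ ∈ D, (famCount E (fun J => J) R₀ : ℝ) ≤ 12 * C_B * (X ^ 3 * X ^ (-τ)) := by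
    have hcardD : (#D : ℝ) ≤ 12 * X := by
      have hsub : D ⊆ (Literature.NumberTheory.LFunctions.NumberField.finite_primeIdealsLE K (6 * X ^ 2)).toFinset.filter
          fun P => ¬ (Ideal.absNorm P).Prime := monotone_filter_right _ fun P _ h => h.1
      have hsqrt : Real.sqrt (6 * X ^ 2) ≤ 3 * X := by
        rw [Real.sqrt_le_left (by positivity)]; nlinarith
      calc (#D : ℝ) ≤ #((Literature.NumberTheory.LFunctions.NumberField.finite_primeIdealsLE K (6 * X ^ 2)).toFinset.filter
            fun P => ¬ (Ideal.absNorm P).Prime) := by exact_mod_cast card_le_card hsub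
        _ ≤ Module.finrank ℚ K * (Real.sqrt (6 * X ^ 2) + 1) := card_filter_not_prime_absNorm_le _
        _ = 3 * (Real.sqrt (6 * X ^ 2) + 1) := by rw [finrank_K]; norm_num
        _ ≤ 12 * X := by linarith
    have hterm : ∀ R₀ ∈ D, (famCount E (fun J => J) R₀ : ℝ) ≤ C_B * X ^ 3 / X ^ (1 + τ) := by
      intro R₀ hR₀
      obtain ⟨-, h0, -, h4⟩ := hDmem R₀ hR₀
      exact (hcount R₀ h0).trans (div_le_div_of_nonneg_left (by positivity) hX1τ h4)
    calc ∑ R₀ ∈ D, (famCount E (fun J => J) R₀ : ℝ) ≤ ∑ R₀ ∈ D, C_B * X ^ 3 / X ^ (1 + τ) := sum_le_sum hterm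
      _ = #D * (C_B * X ^ 3 / X ^ (1 + τ)) := by rw [sum_const, nsmul_eq_mul]
      _ ≤ 12 * X * (C_B * X ^ 3 / X ^ (1 + τ)) := mul_le_mul_of_nonneg_right hcardD (by positivity)
      _ = 12 * C_B * (X ^ 3 * (X / X ^ (1 + τ))) := by ring
      _ = 12 * C_B * (X ^ 3 * X ^ (-τ)) := by
          congr 2
          rw [show X / X ^ (1 + τ) = X ^ (1 : ℝ) / X ^ (1 + τ) by rw [Real.rpow_one],
            ← Real.rpow_sub hX0]
          ring_nf
  -- absorption
  have hη2 : Real.exp (-2 * Real.log X ^ (1 / 3 : ℝ)) ≤ η ^ 2 := by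
    have : Real.exp (-2 * Real.log X ^ (1 / 3 : ℝ)) = Real.exp (-Real.log X ^ (1 / 3 : ℝ)) ^ 2 := by
      rw [← Real.exp_nat_mul]; ring_nf
    rw [this]
    exact pow_le_pow_left₀ (Real.exp_pos _).le hη 2
  have habs' : X ^ (-τ / 5) * L ^ 3 ≤ τ * η ^ 2 / L := by
    rw [one_mul] at habs
    refine habs.trans ?_
    rw [hL]
    exact div_le_div_of_nonneg_right (mul_le_mul_of_nonneg_left hη2 hτ0.le) (by linarith)
  have hL1 : 1 ≤ L := by linarith
  have herr : 9 * C₇' * X ^ (3 - τ / 5) * L ≤ 9 * C₇' * (τ * η * X ^ 3 / L) := by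
    have h := absorb_le3 (T := 9 * C₇') (δ := τ / 5) (j := 1) hX1.le hL1 (by positivity) hη0.le hη1 hτ0.le
      le_rfl (by norm_num) habs'
    have e : X ^ (3 - τ / 5) = X ^ 3 * X ^ (-(τ / 5)) := rpow_three_sub hX0 (τ / 5)
    rw [pow_one] at h
    calc 9 * C₇' * X ^ (3 - τ / 5) * L = 9 * C₇' * (X ^ 3 * X ^ (-(τ / 5)) * L) := by rw [e]; ring
      _ ≤ _ := h
  have herr1 : 8 * C_B * (X ^ 3 * X ^ (-(1 / 3 : ℝ))) ≤ 8 * C_B * (τ * η * X ^ 3 / L) := by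
    have h := absorb_le3 (T := 8 * C_B) (δ := 1 / 3) (j := 0) hX1.le hL1 (by positivity) hη0.le hη1 hτ0.le
      (by linarith) (by norm_num) habs'
    simpa only [pow_zero, mul_one] using h
  have herr3 : 12 * C_B * (X ^ 3 * X ^ (-τ)) ≤ 12 * C_B * (τ * η * X ^ 3 / L) := by
    have h := absorb_le3 (T := 12 * C_B) (δ := τ) (j := 0) hX1.le hL1 (by positivity) hη0.le hη1 hτ0.le
      (by linarith) (by norm_num) habs'
    simpa only [pow_zero, mul_one] using h
  have hscale : hbXi τ / τ ^ 4 = τ := hbXi_div_pow_four hτ0.ne'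
  rw [hscale]
  have hfinal : 8 * C_B * (τ * η * X ^ 3 / L) + 12 * C_B * (τ * η * X ^ 3 / L) +
      C₇' * (20 + 10 * C₁) * (τ * (η * X ^ 3) / L) + 9 * C₇' * (τ * η * X ^ 3 / L) =
      (C₇' * (29 + 10 * C₁) + 20 * C_B) * τ * (η * X ^ 3 / L) := by ring
  calc _ ≤ _ := hmain
    _ ≤ 8 * C_B * (τ * η * X ^ 3 / L) + 12 * C_B * (τ * η * X ^ 3 / L) +
        C₇' * (20 + 10 * C₁) * (τ * (η * X ^ 3) / L) + 9 * C₇' * (τ * η * X ^ 3 / L) :=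
        add_le_add (add_le_add (add_le_add (hT1.trans herr1) (hT3.trans herr3)) le_rfl) herr
    _ = (C₇' * (29 + 10 * C₁) + 20 * C_B) * τ * (η * X ^ 3 / L) := hfinal

end S4Final

end Literature.NumberTheory.Sieve.CubicSieve

end
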